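/-
Copyright: lit-balaban Phase-2 proof seat p30 (gen 27).  Statement-level skeleton of a published paper; no proof claims beyond what
the kernel checks below.
-/
import Literature.MathematicalPhysics.QuantumFieldTheory.BalabanImbrieJaffe1984to88.BIJ85ScalarPropagatorSupDecayDeriv
import Literature.MathematicalPhysics.QuantumFieldTheory.BalabanImbrieJaffe1984to88.BIJ85TorusTentCutoff
import Literature.MathematicalPhysics.QuantumFieldTheory.BalabanImbrieJaffe1984to88.BIJ85SmallFieldHarmonicAgmon

/-!
# [BalabanImbrieJaffe1985] §7.3 p. 326 ⟵ [Balaban1983RegularityDecay] Theorem p. 573, (1.10)–(1.12): **THE LOCAL MEAN-VALUE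
# (`L² → L^∞`) INEQUALITY AT THE BLOCK SCALE FOR FUNCTIONS HARMONIC FOR `N(u) = ε^{−2}D_u^*D_u + a_k(L^kε)^{−2}L^{kd}Q_k(u)ᴴQ_k(u)` AT
# NON-FLAT `U(1)` FIELDS**, uniformly in `k` (kernel file 2 of 3 of the `δG_k(□, Ω)` value member at small non-flat fields; sibling 1 =
# `BIJ85SmallFieldHarmonicAgmon`, sibling 3 = the (1.11)–(1.12) assembly `BIJ88NeumannPropagatorSmallFieldClose`)

T. Bałaban, J. Imbrie, A. Jaffe, *Renormalization of the Higgs model: minimizers, propagators and the stability of mean field theory*,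
Commun. Math. Phys. **97** (1985) 299–329 [BalabanImbrieJaffe1985], row **C1.Eq7.3.1-7.3.2** (owner r15) / front **C2S14 (β′)** (owner r18);
[7] = T. Bałaban, *Regularity and decay of lattice Green's functions*, Commun. Math. Phys. **89** (1983) 571–597 [Balaban1983RegularityDecay];
the flat kernel inputs are [Balaban1983Higgs3] (2.6)/(2.10) pp. 424–426, p. 437 (rows B3.Eq2.10 / B3.Eq3.11-3.17, owner r15).

statement-level skeleton of published theorems with citation tags; proofs where landed; nothing here is a claim about the Yang–Mills mass gap

PDFs held and re-read this session: `paper:balaban1985-cmp97-bij-higgs-minimizers` p. 326 = PDF 28, lines 18–22: *"These inequalities can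
be proved by an extension of the proofs of [7]. The propagators arising from Δ_k(u_k), under the restriction (7.3.1) on the gauge field, also
satisfy the regularity and decay estimates of [7]."*; `paper:balaban1983-cmp89-regularity-decay` p. 573 = PDF 3, the Theorem: *"(1.10)
|(G_k(Ω,A)f)(x)| ≤ c₀exp(−δ₀dist(x, supp f))‖f‖_∞ … If Ω ⊂ Ω₀, then for δG_k(Ω,Ω₀,A) = G_k(Ω,A) − G_k(Ω₀,A), (1.11) we have the
inequalities … with the additional factor (1.12) on the right hand sides"*.

WHAT THIS FILE PROVES (the objects are p31's whole-torus operator `nOp (α_kL^{kd}) ε⁻¹ u k T` and flat propagator `gBox (α_kL^{kd}) ε⁻¹ 1 k T`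
= pv07's tower `G_k(T_ε, 0)` (`BIJ88NeumannPropagatorFlatDecay.gBox_flat_eq_tower`), gen-26's product tent cutoff `BIJ85TorusTentCutoff.chi`
and sup-balls `ball`, `T = |y₀ − z|_∞` the sup torus distance in fine lattice units):
* §1 **`flat_kernel_value`** — the VALUE envelope of the flat torus block propagator, `|G_k(T_ε,0)(x,x′)| ≤ Cε²L^k/max(|x−x′|_∞,1)^{d−1}`
  (`d ≥ 2`, every volume, `1 ≤ k ≤ K`; p20's piece bounds `gpiece_bounds` summed with p39's `scaleSum_le_max` after
  `(L^j)^{2−d} ≤ L^k(L^j)^{1−d}`; crude near the diagonal, valid at `d = 2`), with `value_eq_sum_pieces`;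
* §2 **`loc_representation_value`** — `ψ(y₀) = Σ G♭(y₀,·)χ·N(u)ψ − Σ G♭(y₀,·)χ·(N(u) − N♭)ψ + Σ((χN♭ − N♭χ)G♭(y₀,·))ψ` for any cutoff with
  `χ(y₀) = 1` (gen-25's localisation identity, here for a VALUE), and the two summations by parts (bond form of the Laplacian commutator,
  the `W`-sum after the per-bond identity; private);
* §3 `ℓ²` bookkeeping (private): Cauchy–Schwarz on a sup-ball against a constant and against the radial profile `T/max(T,1)^{d−1}`
  (`Σ_{T≤ρ}(T/max(T,1)^{d−1})² ≤ 2d3^{d−1}ρ^{4−d}`, `d ≤ 3`), kernel mass of a ball;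
* §4 the four term bounds in `ℓ²` form, for an abstract kernel with envelopes `‖K‖ ≤ A₀/max(T,1)^{d−1}`, `‖K(·+e_ν) − K‖ ≤ A₁/max(T,1)^{d−1}`
  and a field with `|u_{z,μ} − 1| ≤ γT` on `T ≤ 2r`: **`commD_dir_le`** (Laplacian commutator, bond form: `(K₊ − K₋)ψ₋ − ūK₋(uψ₊ − ψ₋) −
  (ū − 1)K₋ψ₋` on the annulus `r − 1 ≤ T ≤ 2r`), **`commQ_le`** (block commutator), **`pertD_dir_le`** (Laplacian perturbation through the
  covariant differences — NOT as a potential, which would cost a factor `L^k`), **`pertQ_le`** (block perturbation, no cancellation needed);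
* §5 **`local_meanValue_abstract`** (the four bounds assembled through §2) and the member of record **`harmonic_meanValue`**: for
  `2 ≤ d ≤ 3`, odd `L > 1`, `a > 0` there is `C > 0` such that for every volume `P` (`P.d = d`, `P.L = L`), every `1 ≤ k ≤ K` with
  `4L^k + 6 ≤` sites per direction, every `y₀`, `u`, `ψ` with `(N(u)ψ)(z) = 0` on `T ≤ 4L^k + 2`, and `γ ≥ 0` with `|u_{z,μ} − 1| ≤ γT` on
  `T ≤ 2L^k`: `‖ψ(y₀)‖·√((L^k)^d) ≤ C(1 + γL^{2k})·√(Σ_{T ≤ 5L^k+2}‖ψ‖²)` — uniformly in `k` (Caccioppoli's inequality of sibling 1 bounds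
  the covariant energy; the flat radius of the cutoff is `r = L^k`).

HOW IT IS USED (sibling 3): `v = G_k(□)f − G_k(Ω)f` is `N(u)`-harmonic on the deep rows of `□`; in the centred axial gauge around a deep
row `x` the transports obey `|u − 1| ≤ Cθ·T` (plaquette smallness `θ`, `θL^{2k} ≤ 1` ⟹ `γL^{2k} ≤ C`), so `harmonic_meanValue` turns the
tilted `ℓ²` mass of `v` near `x` delivered by `BIJ85SmallFieldHarmonicAgmon.agmon_harmonic` into the pointwise (1.11)–(1.12) bound with
k-uniform constants.

HONEST SCOPE.  `2 ≤ d ≤ 3` (the radial square profile needs `d ≤ 3`, the kernel envelopes `d ≥ 2`); whole-torus operator only; `U(1)`;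
the hypothesis is a gauge condition (linear growth of `|u − 1|` from the centre), not (7.3.1) itself — producing such a gauge from
plaquette smallness is gen-25's `gauge_transfer` / `BIJ85CentredAxialGauge`, used in sibling 3; existential constant depending on
`d, L, a` only; the value envelope of §1 is deliberately crude.  DIVERGENCE OF METHOD, disclosed: the print proves [7] (1.10)–(1.12) by the
generalized random walk expansion after a local change of gauge; the mean-value inequality here is the `L² → L^∞` step of an
energy-method proof (Caccioppoli / Agmon), with our own constants; it is a kernel tool and states no estimate of the print by itself.
Kernel lemmas tagged [folklore] are finite sums, Cauchy–Schwarz and real algebra.  Nothing here is summit progress.  Unit `lit-balaban-p30`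
(literature-prover-lit-balaban-p30-g27-0), HOME `run/shared/lean/pub/lit-balaban/`, 2026-08-23.
-/

open scoped BigOperators ComplexConjugate
open Finset Matrix

namespace Literature.MathematicalPhysics.QuantumFieldTheory.BalabanImbrieJaffe1984to88.BIJ85SmallFieldHarmonicMeanValue

open Literature.MathematicalPhysics.QuantumFieldTheory.Balaban1983to89
open LatticeFieldCalculus (supDist)
open B3TorusRadialSums (supDist_comm supDist_eq_zero_iff supDist_le_tdist)
open BIJ85Ineq722Torus (supDist_triangle)
open BIJ88Sect3Statements (U1 toC cfg covD norm_toC toC_one)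
open BIJ88NeumannPropagator227Torus (nOp gBox dN qMatK nOp_eq gBox_univ_mul nOp_conjTranspose conj_mul_toC)
open BIJ88NeumannPropagatorFlatDecay (nOp_flat_eq_tower gBox_flat_eq_tower)
open BIJ85ScalarPropagatorSupDecay (gram_dN_mulVec_apply norm_gram_qMatK_mulVec_le)
open BIJ85ScalarPropagatorSupDecayDeriv (nOp_flat_transpose nOp_flat_mulVec_apply nOp_sub_flat_mulVec_apply commutator_flat_apply
  towerQQ_apply_blockK LinvPow_mul_card_blockK)
open BIJ85TorusTentCutoff (chi chi_nonneg chi_le_one chi_eq_one_of_supDist_le supDist_lt_of_chi_ne_zero abs_chi_shift_sub_le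
  supDist_shift_le_succ supDist_le_shift_succ ball mem_ball card_ball_le sum_le_radial radial_env_one env_neighbour env_far max_cast_succ)
open B1RG242Torus (tower)
open BIJ85BlockAveragesTorus BIJ85BlockAveragesTorusK
open B3Ineq210ZeroTorus (pieceT sum_pieceT)
open B3Sect3KernelsZeroTorus (gpiece gpiece_bounds)
open BIJ85FlatPropagatorKernelDiffs (scaleSum_le_max flat_kernel_diffs)

noncomputable section

/-! ## §1 The VALUE of the flat torus block propagator: `|G_k(T_ε,0)(x,x′)| ≤ Cε²L^k/max(|x−x′|_∞,1)^{d−1}` (`d ≥ 2`) -/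

section KernelValue

variable {P : Params}

/-- kernel: `x^{(2−d)} = (x⁻¹)^{d−2}` as a real power, `x > 0`, `d ≥ 2`. [folklore] -/
private theorem rpow_two_sub_natCast {x : ℝ} (hx : 0 < x) {d : ℕ} (hd : 2 ≤ d) :
    x ^ ((2 : ℝ) - (d : ℝ)) = x⁻¹ ^ (d - 2) := by
  have h : (2 : ℝ) - (d : ℝ) = -((d - 2 : ℕ) : ℝ) := by
    rw [Nat.cast_sub hd]; push_cast; ring
  rw [h, Real.rpow_neg hx.le, Real.rpow_natCast, inv_pow]

/-- kernel: `(L^jε)⁻¹^p = (ε⁻¹)^p·((L^j)⁻¹)^p`. [folklore] -/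
private theorem spacing_inv_pow (P : Params) (j p : ℕ) :
    (P.spacing j)⁻¹ ^ p = (P.eps⁻¹) ^ p * (((P.L : ℝ) ^ j)⁻¹) ^ p := by
  unfold Params.spacing
  rw [mul_inv, mul_pow, mul_comm]

/-- kernel: the exponent of the piece bounds, `δ(L^jε)⁻¹(εn) = δn/L^j`. [folklore] -/
private theorem rate_rewrite (P : Params) (δ : ℝ) (j : ℕ) (n : ℝ) :
    δ * (P.spacing j)⁻¹ * (P.eps * n) = δ * n / (P.L : ℝ) ^ j := by
  unfold Params.spacing
  have hε : P.eps ≠ 0 := P.eps_pos.ne'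
  have hL : (P.L : ℝ) ^ j ≠ 0 := pow_ne_zero _ P.cast_L_pos.ne'
  field_simp

/-- kernel: for `j < k`, `((L^j)⁻¹)^{d−2} ≤ L^k·((L^j)⁻¹)^{d−1}` (`L ≥ 1`, `d ≥ 2`). [folklore] -/
private theorem inv_pow_pred_le {L : ℝ} (hL : 1 ≤ L) {j k d : ℕ} (hjk : j < k) (hd : 2 ≤ d) :
    ((L ^ j)⁻¹) ^ (d - 2) ≤ L ^ k * ((L ^ j)⁻¹) ^ (d - 1) := by
  have hLj : 0 < L ^ j := pow_pos (by linarith) j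
  have hx : L ^ j ≠ 0 := hLj.ne'
  have e : ((L ^ j)⁻¹) ^ (d - 2) = L ^ j * ((L ^ j)⁻¹) ^ (d - 1) := by
    obtain ⟨n, rfl⟩ : ∃ n, d = n + 2 := ⟨d - 2, by omega⟩
    rw [show n + 2 - 2 = n by omega, show n + 2 - 1 = n + 1 by omega, pow_succ]
    field_simp
  rw [e]
  exact mul_le_mul_of_nonneg_right (pow_le_pow_right₀ hL hjk.le) (by positivity)

/-- `G_k(T_ε,0)(x,x′) = ε^d·Σ_{j<k}G^η_{(j)}(x,x′)` — the zero-field torus propagator through the `η^{−d}`-normalised scale pieces (2.6)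
(p20's `gpiece`, p03's `sum_pieceT`). [cite: Balaban1983Higgs3, (2.6) p.424] -/
theorem value_eq_sum_pieces {a msq : ℝ} (ha : 0 < a) (hm : 0 ≤ msq) {k : ℕ} (hk : 1 ≤ k) (x x' : Balaban1983to89.Site P 0) :
    (tower P a msq).G k x x' = P.eps ^ P.d * ∑ j ∈ range k, gpiece P a msq k j x x' := by
  have hεd : P.eps ^ P.d ≠ 0 := pow_ne_zero _ P.eps_pos.ne'
  rw [← sum_pieceT ha hm hk, Matrix.sum_apply, Finset.mul_sum]
  refine sum_congr rfl fun j _ => ?_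
  simp only [gpiece]
  rw [← mul_assoc, mul_inv_cancel₀ hεd, one_mul]

/-- **THE VALUE OF THE FLAT TORUS BLOCK PROPAGATOR** `G_k(T_ε,0) = (−Δ^ε + m² + a_k(L^kε)^{−2}Q_k^*Q_k)^{−1}` (Bałaban's scalar torus tower,
matrix entries in the counting-measure normalisation): for `d ≥ 2`, odd `L > 1`, `a > 0`, `m² ≥ 0` there is `C > 0` (a function of
`d, L, a, m²`) such that for EVERY volume `P` (`P.d = d`, `P.L = L`), every `1 ≤ k ≤ K` and all sites:
`|G(x,x′)| ≤ Cε²L^k/max(|x−x′|_∞,1)^{d−1}` — the piece bounds `|G^η_{(j)}| ≤ C(L^jε)^{2−d}e^{−δ|x−x′|/L^j}` ((2.10), p20's `gpiece_bounds`)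
summed over the scales after `(L^j)^{2−d} ≤ L^k(L^j)^{1−d}` (`j < k`), with p39's scale sum (`scaleSum_le_max`, exponent `d − 1 ≥ 1`);
the DIAGONAL `x = x′` included.  A crude envelope (the near-diagonal truth is `|x−x′|^{2−d}`), sufficient for the local mean-value
inequality below and valid at `d = 2`. [cite: Balaban1983Higgs3, (2.10) p.426, p.437] [cite: BalabanImbrieJaffe1985, (4.6.2) p.313, p.326] -/
theorem flat_kernel_value (d L : ℕ) (hd : 2 ≤ d) (hL : Odd L ∧ 1 < L) {a : ℝ} (ha : 0 < a) {msq : ℝ} (hmsq : 0 ≤ msq) :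
    ∃ C : ℝ, 0 < C ∧ ∀ (P : Params), P.d = d → P.L = L → ∀ k : ℕ, 1 ≤ k → k ≤ P.K →
      ∀ (x x' : Balaban1983to89.Site P 0), |(tower P a msq).G k x x'| ≤ C * P.eps ^ 2 * (P.L : ℝ) ^ k / (max (supDist x x' : ℝ) 1) ^ (d - 1) := by
  obtain ⟨δ, C, hδ, hC, hmain⟩ := gpiece_bounds d L (by omega) hL ha hmsq
  have hL1 : (1 : ℝ) < L := by exact_mod_cast hL.2
  have hL0 : (0 : ℝ) < L := by linarith
  obtain ⟨S₁, hS₁pos, hS₁⟩ := scaleSum_le_max hL1 hδ (p := d - 1) (by omega)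
  refine ⟨C * S₁, mul_pos hC hS₁pos, ?_⟩
  intro P hPd hPL k hk1 hkK x x'
  obtain ⟨hval, -, -, -⟩ := hmain P hPd hPL k hk1 hkK
  subst hPd; subst hPL
  have hd' : 2 ≤ P.d := hd
  have hε : 0 < P.eps := P.eps_pos
  have hLk : (0 : ℝ) < (P.L : ℝ) ^ k := pow_pos P.cast_L_pos k
  -- the sum over the scales against the sup distance
  have hscale : ∑ j ∈ range k, (((P.L : ℝ) ^ j)⁻¹) ^ (P.d - 1) * Real.exp (-(δ * (Site.tdist x x' : ℕ) / (P.L : ℝ) ^ j)) ≤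
      S₁ / (max (supDist x x' : ℝ) 1) ^ (P.d - 1) := by
    refine (hS₁ k (Site.tdist x x')).trans ?_
    refine div_le_div_of_nonneg_left hS₁pos.le (by positivity) ?_
    refine pow_le_pow_left₀ (by positivity) (max_le_max_right 1 ?_) _
    exact_mod_cast supDist_le_tdist x x'
  -- each piece
  have hpiece : ∀ j ∈ range k, |gpiece P a msq k j x x'| ≤
      C * (P.eps⁻¹) ^ (P.d - 2) * (P.L : ℝ) ^ k *
        ((((P.L : ℝ) ^ j)⁻¹) ^ (P.d - 1) * Real.exp (-(δ * (Site.tdist x x' : ℕ) / (P.L : ℝ) ^ j))) := by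
    intro j hj
    have hjk : j < k := mem_range.1 hj
    refine (hval j x x').trans ?_
    rw [rpow_two_sub_natCast (P.spacing_pos j) hd', spacing_inv_pow, rate_rewrite]
    have h1 : (((P.L : ℝ) ^ j)⁻¹) ^ (P.d - 2) ≤ (P.L : ℝ) ^ k * (((P.L : ℝ) ^ j)⁻¹) ^ (P.d - 1) :=
      inv_pow_pred_le hL1.le hjk hd'
    have hexp : 0 ≤ Real.exp (-(δ * ((Site.tdist x x' : ℕ) : ℝ) / (P.L : ℝ) ^ j)) := (Real.exp_pos _).le
    calc C * ((P.eps⁻¹) ^ (P.d - 2) * (((P.L : ℝ) ^ j)⁻¹) ^ (P.d - 2)) * Real.exp (-(δ * ((Site.tdist x x' : ℕ) : ℝ) / (P.L : ℝ) ^ j))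
        ≤ C * ((P.eps⁻¹) ^ (P.d - 2) * ((P.L : ℝ) ^ k * (((P.L : ℝ) ^ j)⁻¹) ^ (P.d - 1))) *
            Real.exp (-(δ * ((Site.tdist x x' : ℕ) : ℝ) / (P.L : ℝ) ^ j)) := by
          refine mul_le_mul_of_nonneg_right (mul_le_mul_of_nonneg_left ?_ hC.le) hexp
          exact mul_le_mul_of_nonneg_left h1 (by positivity)
      _ = _ := by ring
  have hpow : P.eps ^ P.d * (P.eps⁻¹) ^ (P.d - 2) = P.eps ^ 2 := by
    have := hd'
    rw [inv_pow, ← div_eq_mul_inv, div_eq_iff (pow_ne_zero _ hε.ne'), ← pow_add]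
    congr 1; omega
  rw [value_eq_sum_pieces ha hmsq hk1, abs_mul, abs_of_pos (pow_pos hε _)]
  calc P.eps ^ P.d * |∑ j ∈ range k, gpiece P a msq k j x x'|
      ≤ P.eps ^ P.d * ∑ j ∈ range k, |gpiece P a msq k j x x'| :=
        mul_le_mul_of_nonneg_left (abs_sum_le_sum_abs _ _) (by positivity)
    _ ≤ P.eps ^ P.d * ∑ j ∈ range k, C * (P.eps⁻¹) ^ (P.d - 2) * (P.L : ℝ) ^ k *
          ((((P.L : ℝ) ^ j)⁻¹) ^ (P.d - 1) * Real.exp (-(δ * (Site.tdist x x' : ℕ) / (P.L : ℝ) ^ j))) :=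
        mul_le_mul_of_nonneg_left (sum_le_sum hpiece) (by positivity)
    _ = C * (P.L : ℝ) ^ k * (P.eps ^ P.d * (P.eps⁻¹) ^ (P.d - 2)) *
          ∑ j ∈ range k, (((P.L : ℝ) ^ j)⁻¹) ^ (P.d - 1) * Real.exp (-(δ * (Site.tdist x x' : ℕ) / (P.L : ℝ) ^ j)) := by
        rw [← Finset.mul_sum]; ring
    _ ≤ C * (P.L : ℝ) ^ k * (P.eps ^ P.d * (P.eps⁻¹) ^ (P.d - 2)) * (S₁ / (max (supDist x x' : ℝ) 1) ^ (P.d - 1)) :=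
        mul_le_mul_of_nonneg_left hscale (by positivity)
    _ = C * S₁ * P.eps ^ 2 * (P.L : ℝ) ^ k / (max (supDist x x' : ℝ) 1) ^ (P.d - 1) := by rw [hpow]; ring

end KernelValue

/-! ## §2 Algebra: the localized representation of a VALUE through the flat propagator, and the two summations by parts -/

section Algebra

variable {P : Params}

/-- kernel: **the localisation identity** — for any three operators `N♭, N′, X`:
`N♭(Xψ) = X(N′ψ) − X(N′ − N♭)ψ + (N♭X − XN♭)ψ`. [folklore] -/
private theorem loc_identity {n : Type*} [Fintype n] [DecidableEq n] (Nf N' X : Matrix n n ℂ) (ψ : n → ℂ) :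
    Nf *ᵥ (X *ᵥ ψ) = X *ᵥ (N' *ᵥ ψ) - X *ᵥ ((N' - Nf) *ᵥ ψ) + (Nf * X - X * Nf) *ᵥ ψ := by
  rw [sub_mulVec, sub_mulVec, ← mulVec_mulVec, ← mulVec_mulVec, mulVec_sub]
  abel

/-- kernel: **transposition of the commutator** — for `A` symmetric and `X` diagonal, `K·((AX − XA)ψ) = ((XA − AX)K)·ψ`. [folklore] -/
private theorem dot_commutator_transpose {n : Type*} [Fintype n] [DecidableEq n] {A : Matrix n n ℂ} (hA : Aᵀ = A) (d K ψ : n → ℂ) :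
    K ⬝ᵥ ((A * diagonal d - diagonal d * A) *ᵥ ψ) = ((diagonal d * A - A * diagonal d) *ᵥ K) ⬝ᵥ ψ := by
  rw [dotProduct_mulVec, ← mulVec_transpose, transpose_sub, transpose_mul, transpose_mul, diagonal_transpose, hA]

/-- **(E1)–(E3) THE LOCALIZED REPRESENTATION OF A VALUE**: for the whole-torus operators `N′ = N(u)`, `N♭ = N(1)` with `G♭N♭ = 1`, and a
cutoff `χ` with `χ(y₀) = 1`:
`ψ(y₀) = Σ_z K(z)χ(z)(N′ψ)(z) − Σ_z K(z)χ(z)((N′ − N♭)ψ)(z) + Σ_z((XN♭ − N♭X)K)(z)ψ(z)`, `K(z) = G♭(y₀,z)`.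
[cite: BalabanImbrieJaffe1985, (4.6.2) p.313] -/
theorem loc_representation_value {a : ℝ} (ha : 0 < a) {k : ℕ} (hk1 : 1 ≤ k) (hk : k ≤ P.m + P.K) (U : GaugeField P 0 U1)
    (ψ : Balaban1983to89.Site P 0 → ℂ) (χ : Balaban1983to89.Site P 0 → ℂ) (y₀ : Balaban1983to89.Site P 0) (hχ0 : χ y₀ = 1) :
    ψ y₀ =
      ∑ z, gBox (B1RG242Torus.α P a k * (P.L : ℝ) ^ (k * P.d)) P.eps⁻¹ (1 : GaugeField P 0 U1) k univ y₀ z *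
          (χ z * (nOp (B1RG242Torus.α P a k * (P.L : ℝ) ^ (k * P.d)) P.eps⁻¹ U k univ *ᵥ ψ) z)
      - ∑ z, gBox (B1RG242Torus.α P a k * (P.L : ℝ) ^ (k * P.d)) P.eps⁻¹ (1 : GaugeField P 0 U1) k univ y₀ z *
          (χ z * ((nOp (B1RG242Torus.α P a k * (P.L : ℝ) ^ (k * P.d)) P.eps⁻¹ U k univ -
              nOp (B1RG242Torus.α P a k * (P.L : ℝ) ^ (k * P.d)) P.eps⁻¹ (1 : GaugeField P 0 U1) k univ) *ᵥ ψ) z)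
      + ∑ z, ((diagonal χ * nOp (B1RG242Torus.α P a k * (P.L : ℝ) ^ (k * P.d)) P.eps⁻¹ (1 : GaugeField P 0 U1) k univ -
              nOp (B1RG242Torus.α P a k * (P.L : ℝ) ^ (k * P.d)) P.eps⁻¹ (1 : GaugeField P 0 U1) k univ * diagonal χ) *ᵥ
            fun z => gBox (B1RG242Torus.α P a k * (P.L : ℝ) ^ (k * P.d)) P.eps⁻¹ (1 : GaugeField P 0 U1) k univ y₀ z) z * ψ z := by
  set a' : ℝ := B1RG242Torus.α P a k * (P.L : ℝ) ^ (k * P.d) with ha'def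
  set Nf := nOp a' P.eps⁻¹ (1 : GaugeField P 0 U1) k univ with hNf
  set N' := nOp a' P.eps⁻¹ U k univ with hN'
  set Gf := gBox a' P.eps⁻¹ (1 : GaugeField P 0 U1) k univ with hGf
  have hk0 : 0 + k ≤ P.m + P.K := by omega
  have hα : 0 < B1RG242Torus.α P a k :=
    mul_pos (B1.aSeq_pos ha (B1RG242Torus.one_lt_cast_L P) hk1) (inv_pos.2 (pow_pos (P.spacing_pos k) 2))
  have ha' : 0 < a' := mul_pos hα (pow_pos P.cast_L_pos _)
  have hc : P.eps⁻¹ ≠ 0 := inv_ne_zero P.eps_pos.ne'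
  have hGN : Gf * Nf = 1 := (gBox_univ_mul hk0 hc ha' (1 : GaugeField P 0 U1)).1
  set v := Nf *ᵥ (diagonal χ *ᵥ ψ) with hv
  have hE1 : diagonal χ *ᵥ ψ = Gf *ᵥ v := by rw [hv, mulVec_mulVec, hGN, one_mulVec]
  have hy : ψ y₀ = ∑ z, Gf y₀ z * v z := by
    have h := congr_fun hE1 y₀
    rw [mulVec_diagonal, hχ0, one_mul] at h
    rw [h]; rfl
  rw [hy, hv, loc_identity Nf N' (diagonal χ) ψ]
  simp only [Pi.add_apply, Pi.sub_apply, mulVec_diagonal, mul_add, mul_sub, sum_add_distrib, sum_sub_distrib]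
  congr 1
  have ht := dot_commutator_transpose (nOp_flat_transpose a hk) χ (fun z => Gf y₀ z) ψ
  simp only [dotProduct] at ht
  rw [← hNf] at ht
  exact ht

/-- kernel: **the per-bond identity** (`ūu = 1`): `(1−u)a ψ₊ + (1−ū)b ψ₋ = (ū−1)a(uψ₊ − ψ₋) + (1−ū)(b − a)ψ₋`. [folklore] -/
private theorem per_bond_identity {u a b ψp ψm : ℂ} (hu : conj u * u = 1) :
    (1 - u) * a * ψp + (1 - conj u) * b * ψm = (conj u - 1) * a * (u * ψp - ψm) + (1 - conj u) * (b - a) * ψm := by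
  linear_combination (-(a * ψp)) * hu

/-- kernel: **reindexing along a shift** (`z ↦ z + e_μ` is a bijection of the torus): `Σ_z F(z, z−e_μ) = Σ_z F(z+e_μ, z)`. [folklore] -/
private theorem sum_unshift_reindex' (μ : Fin P.d) (F : Balaban1983to89.Site P 0 → Balaban1983to89.Site P 0 → ℂ) :
    ∑ z : Balaban1983to89.Site P 0, F z (z.unshift μ) = ∑ z : Balaban1983to89.Site P 0, F (z.shift μ) z := by
  refine (Fintype.sum_equiv (LatticeFieldCalculus.shiftEquiv μ) _ _ fun z => ?_).symm
  show F (z.shift μ) z = F (z.shift μ) ((z.shift μ).unshift μ)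
  rw [show (z.shift μ).unshift μ = z from (LatticeFieldCalculus.shiftEquiv μ).left_inv z]

/-- kernel: **the `W`-sum after the per-bond identity**: for `|u| = 1` bondwise,
`Σ_z K̃(z)Σ_μ((1−u_{z,μ})ψ(z+e_μ) + (1−ū_{z−e_μ,μ})ψ(z−e_μ)) = Σ_μΣ_z((ū−1)K̃(z)(uψ(z+e_μ) − ψ(z)) + (1−ū)(K̃(z+e_μ) − K̃(z))ψ(z))`.
[folklore] -/
private theorem W_sum_identity (Kt ψ : Balaban1983to89.Site P 0 → ℂ) (u : PBond P 0 → ℂ) (hu : ∀ b, conj (u b) * u b = 1) :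
    ∑ z : Balaban1983to89.Site P 0, Kt z * ∑ μ : Fin P.d,
        ((1 - u ⟨z, μ⟩) * ψ (z.shift μ) + (1 - conj (u ⟨z.unshift μ, μ⟩)) * ψ (z.unshift μ)) =
      ∑ μ : Fin P.d, ∑ z : Balaban1983to89.Site P 0,
        ((conj (u ⟨z, μ⟩) - 1) * Kt z * (u ⟨z, μ⟩ * ψ (z.shift μ) - ψ z) +
          (1 - conj (u ⟨z, μ⟩)) * (Kt (z.shift μ) - Kt z) * ψ z) := by
  simp_rw [mul_sum]
  rw [sum_comm]
  refine sum_congr rfl fun μ _ => ?_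
  simp_rw [mul_add]
  rw [sum_add_distrib, sum_unshift_reindex' μ (fun z w => Kt z * ((1 - conj (u ⟨w, μ⟩)) * ψ w)), ← sum_add_distrib]
  refine sum_congr rfl fun z _ => ?_
  have := per_bond_identity (a := Kt z) (b := Kt (z.shift μ)) (ψp := ψ (z.shift μ)) (ψm := ψ z) (hu ⟨z, μ⟩)
  linear_combination this

/-- kernel: **the Laplacian commutator in bond form** (reindexing the backward half):
`Σ_z(Σ_μ((χ(z+e_μ) − χ(z))K(z+e_μ) + (χ(z−e_μ) − χ(z))K(z−e_μ)))ψ(z) = Σ_μΣ_z(χ(z+e_μ) − χ(z))(K(z+e_μ)ψ(z) − K(z)ψ(z+e_μ))`.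
[folklore] -/
private theorem commD_bond_form (χ K ψ : Balaban1983to89.Site P 0 → ℂ) :
    ∑ z : Balaban1983to89.Site P 0, (∑ μ : Fin P.d,
        ((χ (z.shift μ) - χ z) * K (z.shift μ) + (χ (z.unshift μ) - χ z) * K (z.unshift μ))) * ψ z =
      ∑ μ : Fin P.d, ∑ z : Balaban1983to89.Site P 0, (χ (z.shift μ) - χ z) * (K (z.shift μ) * ψ z - K z * ψ (z.shift μ)) := by
  simp_rw [sum_mul]
  rw [sum_comm]
  refine sum_congr rfl fun μ _ => ?_
  simp_rw [add_mul]
  rw [sum_add_distrib, sum_unshift_reindex' μ (fun z w => (χ w - χ z) * K w * ψ z), ← sum_add_distrib]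
  exact sum_congr rfl fun z _ => by ring

/-- kernel: **the bond term split** (`ūu = 1`): `K₊ψ₋ − K₋ψ₊ = (K₊ − K₋)ψ₋ − ūK₋(uψ₊ − ψ₋) − (ū − 1)K₋ψ₋` — the difference of the kernel,
the covariant difference of `ψ`, and the deviation of the transport from `1`. [folklore] -/
private theorem bond_split {u Kp Km ψp ψm : ℂ} (hu : conj u * u = 1) :
    Kp * ψm - Km * ψp = (Kp - Km) * ψm - conj u * Km * (u * ψp - ψm) - (conj u - 1) * Km * ψm := by
  linear_combination (Km * ψp) * hu

end Algebra

/-! ## §3 `ℓ²` bookkeeping: Cauchy–Schwarz on a sup-ball, against a constant and against the profile `T/max(T,1)^{d−1}` -/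

section L2

variable {P : Params}

/-- kernel: finite Cauchy–Schwarz in square-root form. [folklore] -/
private theorem cs_sqrt {ι : Type*} (S : Finset ι) (u v : ι → ℝ) :
    ∑ p ∈ S, u p * v p ≤ Real.sqrt (∑ p ∈ S, u p ^ 2) * Real.sqrt (∑ p ∈ S, v p ^ 2) := by
  rw [← Real.sqrt_mul (Finset.sum_nonneg fun p _ => sq_nonneg (u p))]
  exact (le_abs_self _).trans (Real.abs_le_sqrt (Finset.sum_mul_sq_le_sq_mul_sq S u v))

/-- kernel: **Cauchy–Schwarz on a sup-ball**: a weight `a` vanishing off the ball `|y₀ − z|_∞ ≤ ρ` with `Σ_{ball}a² ≤ Q` has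
`Σ_z a(z)‖g(z)‖ ≤ √Q·√(Σ_{ball}‖g‖²)`. [folklore] -/
private theorem cs_ball (y₀ : Balaban1983to89.Site P 0) (ρ : ℕ) (a : Balaban1983to89.Site P 0 → ℝ) (g : Balaban1983to89.Site P 0 → ℂ)
    (hout : ∀ z, ρ < supDist y₀ z → a z = 0) {Q : ℝ} (hQ : ∑ z ∈ ball y₀ ρ, a z ^ 2 ≤ Q) :
    ∑ z, a z * ‖g z‖ ≤ Real.sqrt Q * Real.sqrt (∑ z ∈ ball y₀ ρ, ‖g z‖ ^ 2) := by
  classical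
  have h1 : ∑ z, a z * ‖g z‖ = ∑ z ∈ ball y₀ ρ, a z * ‖g z‖ := by
    refine (Finset.sum_subset (Finset.subset_univ (ball y₀ ρ)) ?_).symm
    intro z _ hz
    rw [mem_ball, not_le] at hz
    rw [hout z hz, zero_mul]
  rw [h1]
  exact (cs_sqrt _ _ _).trans (mul_le_mul_of_nonneg_right (Real.sqrt_le_sqrt hQ) (Real.sqrt_nonneg _))

/-- kernel: **Cauchy–Schwarz against a constant majorant**: `|a| ≤ c` on the ball, `a = 0` off it ⟹
`Σ_z a(z)‖g(z)‖ ≤ c√((2ρ+1)^d)·√(Σ_{ball}‖g‖²)` (the ball has at most `(2ρ+1)^d` sites). [folklore] -/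
private theorem cs_ball_const (y₀ : Balaban1983to89.Site P 0) (ρ : ℕ) (a : Balaban1983to89.Site P 0 → ℝ)
    (g : Balaban1983to89.Site P 0 → ℂ) {c : ℝ} (hc : 0 ≤ c) (ha : ∀ z, |a z| ≤ c) (hout : ∀ z, ρ < supDist y₀ z → a z = 0) :
    ∑ z, a z * ‖g z‖ ≤ c * Real.sqrt ((2 * ρ + 1 : ℝ) ^ P.d) * Real.sqrt (∑ z ∈ ball y₀ ρ, ‖g z‖ ^ 2) := by
  have hQ : ∑ z ∈ ball y₀ ρ, a z ^ 2 ≤ c ^ 2 * (2 * ρ + 1 : ℝ) ^ P.d := by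
    calc ∑ z ∈ ball y₀ ρ, a z ^ 2 ≤ ∑ _z ∈ ball y₀ ρ, c ^ 2 :=
          sum_le_sum fun z _ => by rw [← sq_abs]; exact pow_le_pow_left₀ (abs_nonneg _) (ha z) 2
      _ = (ball y₀ ρ).card * c ^ 2 := by rw [sum_const, nsmul_eq_mul]
      _ ≤ (2 * ρ + 1 : ℝ) ^ P.d * c ^ 2 :=
          mul_le_mul_of_nonneg_right (by exact_mod_cast card_ball_le y₀ ρ) (sq_nonneg _)
      _ = c ^ 2 * (2 * ρ + 1 : ℝ) ^ P.d := mul_comm _ _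
  refine (cs_ball y₀ ρ a g hout hQ).trans (le_of_eq ?_)
  rw [Real.sqrt_mul (sq_nonneg c), Real.sqrt_sq hc]

/-- kernel: **the radial square profile** (`d ≤ 3`): `Σ_{|y₀−z|_∞ ≤ ρ}(A·T/max(T,1)^{d−1})² ≤ 2d3^{d−1}A²ρ^{4−d}` for a weight
`|a| ≤ A·T/max(T,1)^{d−1}` (`T = |y₀ − z|_∞`; shell of radius `s ≥ 1` has `≤ 2d(2s+1)^{d−1} ≤ 2d3^{d−1}s^{d−1}` sites and carries
`A²s^{4−2d}`; `s^{3−d} ≤ ρ^{3−d}`). [folklore] -/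
private theorem sum_sq_T_le (hd3 : P.d ≤ 3) (y₀ : Balaban1983to89.Site P 0) (ρ : ℕ) {A : ℝ}
    (a : Balaban1983to89.Site P 0 → ℝ)
    (ha : ∀ z, supDist y₀ z ≤ ρ → |a z| ≤ A * (supDist y₀ z : ℝ) / (max (supDist y₀ z : ℝ) 1) ^ (P.d - 1))
    (hout : ∀ z, ρ < supDist y₀ z → a z = 0) :
    ∑ z ∈ ball y₀ ρ, a z ^ 2 ≤ 2 * P.d * 3 ^ (P.d - 1) * A ^ 2 * (ρ : ℝ) ^ (4 - P.d) := by
  classical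
  have hd := P.hd
  obtain ⟨D, hD⟩ : ∃ D, P.d = D + 1 := ⟨P.d - 1, by omega⟩
  obtain ⟨e, he⟩ : ∃ e, D + e = 2 := ⟨2 - D, by omega⟩
  have hDd : P.d - 1 = D := by omega
  have h4 : 4 - P.d = e + 1 := by omega
  -- the sum over the ball is the sum over the torus
  have hball : ∑ z ∈ ball y₀ ρ, a z ^ 2 = ∑ z, a z ^ 2 := by
    refine Finset.sum_subset (Finset.subset_univ _) fun z _ hz => ?_
    rw [mem_ball, not_le] at hz
    rw [hout z hz]; ring
  rw [hball]
  set Fb : ℕ → ℝ := fun s => (A * (s : ℝ) / (max (s : ℝ) 1) ^ (P.d - 1)) ^ 2 with hFb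
  have h1 := sum_le_radial y₀ ρ Fb (fun s => sq_nonneg _) (fun z => a z ^ 2)
    (fun z hz => by rw [hFb, ← sq_abs]; exact pow_le_pow_left₀ (abs_nonneg _) (ha z hz) 2)
    (fun z hz => by rw [hout z hz]; simp)
  refine h1.trans ?_
  have hF0 : Fb 0 = 0 := by simp [hFb]
  rw [hF0, zero_add]
  have hterm : ∀ i ∈ Finset.range ρ, 2 * (P.d : ℝ) * (2 * ((i + 1 : ℕ) : ℝ) + 1) ^ (P.d - 1) * Fb (i + 1) ≤
      2 * P.d * 3 ^ (P.d - 1) * A ^ 2 * (ρ : ℝ) ^ e := by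
    intro i hi
    rw [Finset.mem_range] at hi
    have hs : (1 : ℝ) ≤ ((i + 1 : ℕ) : ℝ) := by exact_mod_cast Nat.succ_pos i
    have hs0 : (0 : ℝ) < ((i + 1 : ℕ) : ℝ) := by positivity
    have hsρ : ((i + 1 : ℕ) : ℝ) ≤ ρ := by exact_mod_cast hi
    have hshell := BIJ85TorusTentCutoff.shellFactor_le hs (P.d - 1)
    have hFb1 : Fb (i + 1) = A ^ 2 * ((i + 1 : ℕ) : ℝ) ^ 2 / (((i + 1 : ℕ) : ℝ) ^ D) ^ 2 := by
      rw [hFb]; simp only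
      rw [Nat.cast_add, Nat.cast_one] at *
      rw [max_eq_left hs, hDd]; ring
    rw [hFb1, hDd]
    -- `s^{d-1}·s²/s^{2(d-1)} = s^{e}` with `D + e = 2`
    have hkey : (3 : ℝ) ^ D * ((i + 1 : ℕ) : ℝ) ^ D * (A ^ 2 * ((i + 1 : ℕ) : ℝ) ^ 2 / (((i + 1 : ℕ) : ℝ) ^ D) ^ 2) =
        3 ^ D * A ^ 2 * ((i + 1 : ℕ) : ℝ) ^ e := by
      have hs2 : ((i + 1 : ℕ) : ℝ) ^ 2 = ((i + 1 : ℕ) : ℝ) ^ D * ((i + 1 : ℕ) : ℝ) ^ e := by rw [← pow_add, he]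
      rw [hs2]; field_simp
    have hse : ((i + 1 : ℕ) : ℝ) ^ e ≤ (ρ : ℝ) ^ e := pow_le_pow_left₀ hs0.le hsρ e
    calc 2 * (P.d : ℝ) * (2 * ((i + 1 : ℕ) : ℝ) + 1) ^ D * (A ^ 2 * ((i + 1 : ℕ) : ℝ) ^ 2 / (((i + 1 : ℕ) : ℝ) ^ D) ^ 2)
        ≤ 2 * P.d * (3 ^ D * ((i + 1 : ℕ) : ℝ) ^ D) * (A ^ 2 * ((i + 1 : ℕ) : ℝ) ^ 2 / (((i + 1 : ℕ) : ℝ) ^ D) ^ 2) := by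
          rw [hDd] at hshell; gcongr
      _ = 2 * P.d * (3 ^ D * A ^ 2 * ((i + 1 : ℕ) : ℝ) ^ e) := by rw [← hkey]; ring
      _ ≤ 2 * P.d * (3 ^ D * A ^ 2 * (ρ : ℝ) ^ e) := by gcongr
      _ = 2 * P.d * 3 ^ D * A ^ 2 * (ρ : ℝ) ^ e := by ring
  calc ∑ i ∈ Finset.range ρ, 2 * (P.d : ℝ) * (2 * ((i + 1 : ℕ) : ℝ) + 1) ^ (P.d - 1) * Fb (i + 1)
      ≤ ∑ _i ∈ Finset.range ρ, 2 * (P.d : ℝ) * 3 ^ (P.d - 1) * A ^ 2 * (ρ : ℝ) ^ e := Finset.sum_le_sum hterm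
    _ = 2 * P.d * 3 ^ (P.d - 1) * A ^ 2 * (ρ : ℝ) ^ (4 - P.d) := by
        rw [Finset.sum_const, Finset.card_range, nsmul_eq_mul, h4, pow_succ]; ring

/-- kernel: **Cauchy–Schwarz against the profile `T/max(T,1)^{d−1}`** (`d ≤ 3`):
`Σ_z a(z)‖g(z)‖ ≤ A√(2d3^{d−1}ρ^{4−d})·√(Σ_{ball}‖g‖²)`. [folklore] -/
private theorem cs_ball_T (hd3 : P.d ≤ 3) (y₀ : Balaban1983to89.Site P 0) (ρ : ℕ) (a : Balaban1983to89.Site P 0 → ℝ)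
    (g : Balaban1983to89.Site P 0 → ℂ) {A : ℝ} (hA : 0 ≤ A)
    (ha : ∀ z, supDist y₀ z ≤ ρ → |a z| ≤ A * (supDist y₀ z : ℝ) / (max (supDist y₀ z : ℝ) 1) ^ (P.d - 1))
    (hout : ∀ z, ρ < supDist y₀ z → a z = 0) :
    ∑ z, a z * ‖g z‖ ≤ A * Real.sqrt (2 * P.d * 3 ^ (P.d - 1) * (ρ : ℝ) ^ (4 - P.d)) * Real.sqrt (∑ z ∈ ball y₀ ρ, ‖g z‖ ^ 2) := by
  have hQ := sum_sq_T_le hd3 y₀ ρ a ha hout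
  have hQ' : ∑ z ∈ ball y₀ ρ, a z ^ 2 ≤ A ^ 2 * (2 * P.d * 3 ^ (P.d - 1) * (ρ : ℝ) ^ (4 - P.d)) := by linarith [hQ]
  refine (cs_ball y₀ ρ a g hout hQ').trans (le_of_eq ?_)
  rw [Real.sqrt_mul (sq_nonneg A), Real.sqrt_sq hA]

/-- kernel: **the kernel mass of a ball**: `Σ_{|y₀−z|_∞ ≤ ρ}‖K(z)‖ ≤ A(1 + 2d3^{d−1}ρ)` for `‖K‖ ≤ A/max(T,1)^{d−1}`. [folklore] -/
private theorem sum_ball_norm_le (y₀ : Balaban1983to89.Site P 0) (ρ : ℕ) {A : ℝ} (hA : 0 ≤ A) (K : Balaban1983to89.Site P 0 → ℂ)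
    (hK : ∀ z, ‖K z‖ ≤ A / (max (supDist y₀ z : ℝ) 1) ^ (P.d - 1)) :
    ∑ z ∈ ball y₀ ρ, ‖K z‖ ≤ A * (1 + 2 * P.d * 3 ^ (P.d - 1) * ρ) := by
  classical
  have h := radial_env_one P.hd y₀ ρ hA (fun z => if supDist y₀ z ≤ ρ then ‖K z‖ else 0)
    (fun z hz => by simp only [if_pos hz]; exact hK z) (fun z hz => by simp only [if_neg (not_le.2 hz)]; exact le_rfl)
  have e : ∑ z ∈ ball y₀ ρ, ‖K z‖ = ∑ z, (if supDist y₀ z ≤ ρ then ‖K z‖ else 0) := by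
    simp only [ball, Finset.sum_filter]
  rw [e]; exact h

/-- kernel: the `μ`-th bond energy on a ball is at most the total bond energy there. [folklore] -/
private theorem sqrt_dir_le (y₀ : Balaban1983to89.Site P 0) (ρ : ℕ) (w : Balaban1983to89.Site P 0 → Fin P.d → ℂ) (μ : Fin P.d) :
    Real.sqrt (∑ z ∈ ball y₀ ρ, ‖w z μ‖ ^ 2) ≤ Real.sqrt (∑ z ∈ ball y₀ ρ, ∑ ν, ‖w z ν‖ ^ 2) :=
  Real.sqrt_le_sqrt (sum_le_sum fun z _ => Finset.single_le_sum (f := fun ν => ‖w z ν‖ ^ 2) (fun _ _ => sq_nonneg _) (mem_univ μ))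

end L2

/-! ## §4 The four term bounds in `ℓ²` form -/

section Terms

variable {P : Params}

/-- **THE LAPLACIAN COMMUTATOR, ONE DIRECTION** (bond form, `r ≥ 2`): with `|u| = 1` bondwise, `|u_{z,μ} − 1| ≤ γ|y₀ − z|_∞` on the ball
`T ≤ 2r`, and the kernel envelopes `‖K‖ ≤ A₀/max(T,1)^{d−1}`, `‖K(·+e_ν) − K‖ ≤ A₁/max(T,1)^{d−1}`:
`‖Σ_z(χ(z+e_μ) − χ(z))(K(z+e_μ)ψ(z) − K(z)ψ(z+e_μ))‖ ≤ (2/r)^{d−1}r⁻¹√((4r+1)^d)·(A₁E + A₀W_μ + 2γrA₀E)` (`r ≥ 2`),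
`E = √(Σ_{T≤2r}‖ψ‖²)`, `W_μ = √(Σ_{T≤2r}‖u_{z,μ}ψ(z+e_μ) − ψ(z)‖²)` — the bond difference of `χ` lives on the annulus `r − 1 ≤ T ≤ 2r`
and is `≤ 1/r`; the bond term splits as `(K₊ − K₋)ψ₋ − ūK₋(uψ₊ − ψ₋) − (ū − 1)K₋ψ₋`. [cite: BalabanImbrieJaffe1985, (4.6.3) p.313, p.326] -/
theorem commD_dir_le {r : ℕ} (hr : 2 ≤ r) (hN : 4 * r + 6 ≤ P.sitesPerDir 0) (y₀ : Balaban1983to89.Site P 0)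
    (K ψ : Balaban1983to89.Site P 0 → ℂ) (u : PBond P 0 → ℂ) (hu1 : ∀ b, conj (u b) * u b = 1) (hun : ∀ b, ‖u b‖ = 1)
    {A₀ A₁ γ : ℝ} (hA₀ : 0 ≤ A₀) (hA₁ : 0 ≤ A₁) (hγ : 0 ≤ γ)
    (hK0 : ∀ z, ‖K z‖ ≤ A₀ / (max (supDist y₀ z : ℝ) 1) ^ (P.d - 1))
    (hK1 : ∀ z (ν : Fin P.d), ‖K (z.shift ν) - K z‖ ≤ A₁ / (max (supDist y₀ z : ℝ) 1) ^ (P.d - 1))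
    (hu : ∀ z (μ : Fin P.d), supDist y₀ z ≤ 2 * r → ‖u ⟨z, μ⟩ - 1‖ ≤ γ * supDist y₀ z) (μ : Fin P.d) :
    ‖∑ z : Balaban1983to89.Site P 0, (((chi y₀ r (z.shift μ) : ℝ) : ℂ) - ((chi y₀ r z : ℝ) : ℂ)) *
        (K (z.shift μ) * ψ z - K z * ψ (z.shift μ))‖ ≤
      (2 / (r : ℝ)) ^ (P.d - 1) / r * Real.sqrt ((2 * (2 * r : ℕ) + 1 : ℝ) ^ P.d) *
        (A₁ * Real.sqrt (∑ z ∈ ball y₀ (2 * r), ‖ψ z‖ ^ 2) +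
          A₀ * Real.sqrt (∑ z ∈ ball y₀ (2 * r), ‖u ⟨z, μ⟩ * ψ (z.shift μ) - ψ z‖ ^ 2) +
          2 * γ * r * A₀ * Real.sqrt (∑ z ∈ ball y₀ (2 * r), ‖ψ z‖ ^ 2)) := by
  have hr1 : 1 ≤ r := by omega
  have hr0 : (0 : ℝ) < r := by exact_mod_cast (show 0 < r by omega)
  set E := Real.sqrt (∑ z ∈ ball y₀ (2 * r), ‖ψ z‖ ^ 2) with hE
  set Wμ := Real.sqrt (∑ z ∈ ball y₀ (2 * r), ‖u ⟨z, μ⟩ * ψ (z.shift μ) - ψ z‖ ^ 2) with hW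
  set B := Real.sqrt ((2 * (2 * r : ℕ) + 1 : ℝ) ^ P.d) with hB
  set env : ℝ := (2 / (r : ℝ)) ^ (P.d - 1) with henv
  have henv0 : 0 ≤ env := by positivity
  -- the three weights
  set dχ : Balaban1983to89.Site P 0 → ℝ := fun z => |chi y₀ r (z.shift μ) - chi y₀ r z| with hdχ
  set a₁ : Balaban1983to89.Site P 0 → ℝ := fun z => dχ z * ‖K (z.shift μ) - K z‖ with ha₁
  set a₂ : Balaban1983to89.Site P 0 → ℝ := fun z => dχ z * ‖K z‖ with ha₂
  set a₃ : Balaban1983to89.Site P 0 → ℝ := fun z => dχ z * (‖u ⟨z, μ⟩ - 1‖ * ‖K z‖) with ha₃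
  -- where `dχ ≠ 0`: the annulus
  have hann : ∀ z, dχ z ≠ 0 → r ≤ supDist y₀ z + 1 ∧ supDist y₀ z ≤ 2 * r := by
    intro z hz
    have hne : chi y₀ r (z.shift μ) ≠ chi y₀ r z := fun h => hz (by rw [hdχ]; simp [h])
    exact ⟨BIJ85TorusTentCutoff.le_supDist_of_chi_shift_ne hr1 hN hne, BIJ85TorusTentCutoff.supDist_le_of_chi_shift_ne hr1 hne⟩
  have hdχ0 : ∀ z, 0 ≤ dχ z := fun z => abs_nonneg _
  have hdχ1 : ∀ z, dχ z ≤ 1 / r := fun z => abs_chi_shift_sub_le hr1 hN y₀ z μ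
  have hout : ∀ z, 2 * r < supDist y₀ z → dχ z = 0 := by
    intro z hz; by_contra h; have := (hann z h).2; omega
  -- the envelopes on the annulus
  have hfar : ∀ z, dχ z ≠ 0 → (r : ℝ) / 2 ≤ (supDist y₀ z : ℝ) := by
    intro z hz
    have h1 : (r : ℝ) ≤ supDist y₀ z + 1 := by exact_mod_cast (hann z hz).1
    have h4 : (2 : ℝ) ≤ r := by exact_mod_cast hr
    linarith
  have hK0' : ∀ z, dχ z ≠ 0 → ‖K z‖ ≤ A₀ * env := fun z hz =>
    (hK0 z).trans (by rw [henv]; exact env_far hr0 (hfar z hz) _ hA₀)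
  have hK1' : ∀ z, dχ z ≠ 0 → ‖K (z.shift μ) - K z‖ ≤ A₁ * env := fun z hz =>
    (hK1 z μ).trans (by rw [henv]; exact env_far hr0 (hfar z hz) _ hA₁)
  have hu' : ∀ z, dχ z ≠ 0 → ‖u ⟨z, μ⟩ - 1‖ ≤ 2 * γ * r := by
    intro z hz
    refine (hu z μ (hann z hz).2).trans ?_
    have : (supDist y₀ z : ℝ) ≤ 2 * r := by exact_mod_cast (hann z hz).2
    nlinarith
  -- constant majorants
  have hb₁ : ∀ z, |a₁ z| ≤ 1 / r * (A₁ * env) := by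
    intro z
    rw [ha₁]; simp only; rw [abs_of_nonneg (mul_nonneg (hdχ0 z) (norm_nonneg _))]
    by_cases hz : dχ z = 0
    · rw [hz, zero_mul]; positivity
    · exact mul_le_mul (hdχ1 z) (hK1' z hz) (norm_nonneg _) (by positivity)
  have hb₂ : ∀ z, |a₂ z| ≤ 1 / r * (A₀ * env) := by
    intro z
    rw [ha₂]; simp only; rw [abs_of_nonneg (mul_nonneg (hdχ0 z) (norm_nonneg _))]
    by_cases hz : dχ z = 0
    · rw [hz, zero_mul]; positivity
    · exact mul_le_mul (hdχ1 z) (hK0' z hz) (norm_nonneg _) (by positivity)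
  have hb₃ : ∀ z, |a₃ z| ≤ 1 / r * (2 * γ * r * (A₀ * env)) := by
    intro z
    rw [ha₃]; simp only; rw [abs_of_nonneg (mul_nonneg (hdχ0 z) (mul_nonneg (norm_nonneg _) (norm_nonneg _)))]
    by_cases hz : dχ z = 0
    · rw [hz, zero_mul]; positivity
    · exact mul_le_mul (hdχ1 z) (mul_le_mul (hu' z hz) (hK0' z hz) (norm_nonneg _) (by positivity))
        (mul_nonneg (norm_nonneg _) (norm_nonneg _)) (by positivity)
  have ho₁ : ∀ z, 2 * r < supDist y₀ z → a₁ z = 0 := fun z hz => by rw [ha₁]; simp only; rw [hout z hz, zero_mul]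
  have ho₂ : ∀ z, 2 * r < supDist y₀ z → a₂ z = 0 := fun z hz => by rw [ha₂]; simp only; rw [hout z hz, zero_mul]
  have ho₃ : ∀ z, 2 * r < supDist y₀ z → a₃ z = 0 := fun z hz => by rw [ha₃]; simp only; rw [hout z hz, zero_mul]
  -- Cauchy–Schwarz for the three pieces
  have hS₁ := cs_ball_const y₀ (2 * r) a₁ ψ (by positivity : (0 : ℝ) ≤ 1 / r * (A₁ * env)) hb₁ ho₁
  have hS₂ := cs_ball_const y₀ (2 * r) a₂ (fun z => u ⟨z, μ⟩ * ψ (z.shift μ) - ψ z)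
    (by positivity : (0 : ℝ) ≤ 1 / r * (A₀ * env)) hb₂ ho₂
  have hS₃ := cs_ball_const y₀ (2 * r) a₃ ψ (by positivity : (0 : ℝ) ≤ 1 / r * (2 * γ * r * (A₀ * env))) hb₃ ho₃
  -- pointwise splitting of the bond term
  have hpt : ∀ z, ‖(((chi y₀ r (z.shift μ) : ℝ) : ℂ) - ((chi y₀ r z : ℝ) : ℂ)) * (K (z.shift μ) * ψ z - K z * ψ (z.shift μ))‖ ≤
      a₁ z * ‖ψ z‖ + a₂ z * ‖u ⟨z, μ⟩ * ψ (z.shift μ) - ψ z‖ + a₃ z * ‖ψ z‖ := by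
    intro z
    rw [bond_split (Kp := K (z.shift μ)) (Km := K z) (ψp := ψ (z.shift μ)) (ψm := ψ z) (hu1 ⟨z, μ⟩), norm_mul,
      ← Complex.ofReal_sub, Complex.norm_real, Real.norm_eq_abs]
    have hcu : ‖conj (u ⟨z, μ⟩)‖ = 1 := by rw [Complex.norm_conj, hun]
    have hcu1 : ‖conj (u ⟨z, μ⟩) - 1‖ = ‖u ⟨z, μ⟩ - 1‖ := by
      rw [← Complex.norm_conj, map_sub, Complex.conj_conj, map_one]
    have h3 : ‖(K (z.shift μ) - K z) * ψ z - conj (u ⟨z, μ⟩) * K z * (u ⟨z, μ⟩ * ψ (z.shift μ) - ψ z) -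
        (conj (u ⟨z, μ⟩) - 1) * K z * ψ z‖ ≤
        ‖K (z.shift μ) - K z‖ * ‖ψ z‖ + ‖K z‖ * ‖u ⟨z, μ⟩ * ψ (z.shift μ) - ψ z‖ + ‖u ⟨z, μ⟩ - 1‖ * ‖K z‖ * ‖ψ z‖ := by
      refine (norm_sub_le _ _).trans ?_
      refine (add_le_add (norm_sub_le _ _) le_rfl).trans (le_of_eq ?_)
      rw [norm_mul, norm_mul, norm_mul, norm_mul, norm_mul, hcu, one_mul, hcu1]
    calc |chi y₀ r (z.shift μ) - chi y₀ r z| * ‖(K (z.shift μ) - K z) * ψ z -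
          conj (u ⟨z, μ⟩) * K z * (u ⟨z, μ⟩ * ψ (z.shift μ) - ψ z) - (conj (u ⟨z, μ⟩) - 1) * K z * ψ z‖
        ≤ dχ z * (‖K (z.shift μ) - K z‖ * ‖ψ z‖ + ‖K z‖ * ‖u ⟨z, μ⟩ * ψ (z.shift μ) - ψ z‖ +
            ‖u ⟨z, μ⟩ - 1‖ * ‖K z‖ * ‖ψ z‖) := mul_le_mul_of_nonneg_left h3 (hdχ0 z)
      _ = a₁ z * ‖ψ z‖ + a₂ z * ‖u ⟨z, μ⟩ * ψ (z.shift μ) - ψ z‖ + a₃ z * ‖ψ z‖ := by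
          simp only [ha₁, ha₂, ha₃]; ring
  calc _ ≤ ∑ z, (a₁ z * ‖ψ z‖ + a₂ z * ‖u ⟨z, μ⟩ * ψ (z.shift μ) - ψ z‖ + a₃ z * ‖ψ z‖) :=
        (norm_sum_le _ _).trans (sum_le_sum fun z _ => hpt z)
    _ = ∑ z, a₁ z * ‖ψ z‖ + ∑ z, a₂ z * ‖u ⟨z, μ⟩ * ψ (z.shift μ) - ψ z‖ + ∑ z, a₃ z * ‖ψ z‖ := by
        rw [sum_add_distrib, sum_add_distrib]
    _ ≤ 1 / r * (A₁ * env) * B * E + 1 / r * (A₀ * env) * B * Wμ + 1 / r * (2 * γ * r * (A₀ * env)) * B * E :=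
        add_le_add (add_le_add hS₁ hS₂) hS₃
    _ = env / r * B * (A₁ * E + A₀ * Wμ + 2 * γ * r * A₀ * E) := by ring

/-- kernel: the normalisation of the covariant block Gram matrix, `ν_k = L^{−kd}·(L^{−d})^k = N⁻²`. [cite: BalabanImbrieJaffe1985, (2.6) p.303] -/
private theorem gram_le {k : ℕ} (hk : k ≤ P.m + P.K) (U : GaugeField P 0 U1) (φ : Balaban1983to89.Site P 0 → ℂ)
    (z : Balaban1983to89.Site P 0) :
    ‖(((qMatK U k univ)ᴴ * qMatK U k univ) *ᵥ φ) z‖ ≤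
      ((P.L : ℝ) ^ (k * P.d))⁻¹ * (((P.L : ℝ) ^ P.d)⁻¹) ^ k * ∑ z' ∈ blockK k (blkIter k z), ‖φ z'‖ := by
  have h := norm_gram_qMatK_mulVec_le hk U φ z
  rw [towerQQ_apply_blockK hk] at h
  simpa only [mul_assoc] using h

/-- kernel: a `k`-block around a site of the ball `T ≤ ρ` lies in the ball `T ≤ ρ + L^k`. [cite: BalabanImbrieJaffe1985, (5.1.2)–(5.1.3) p.313] -/
private theorem blockK_subset_ball {k : ℕ} (hk : k ≤ P.m + P.K) {y₀ z : Balaban1983to89.Site P 0} {ρ : ℕ} (hz : supDist y₀ z ≤ ρ) :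
    blockK k (blkIter k z) ⊆ ball y₀ (ρ + P.L ^ k) := by
  intro z' hz'
  rw [mem_ball]
  have h1 : supDist z z' ≤ P.L ^ k :=
    BIJ85ScalarPropagatorSupDecayDeriv.supDist_le_of_blkIter_eq' hk ((mem_blockK.1 hz').symm)
  have h2 := supDist_triangle y₀ z z'
  omega

/-- kernel: `Σ_{ball}‖g‖ ≤ √((2ρ+1)^d)·√(Σ_{ball}‖g‖²)`. [folklore] -/
private theorem sum_ball_norm_le_sqrt (y₀ : Balaban1983to89.Site P 0) (ρ : ℕ) (g : Balaban1983to89.Site P 0 → ℂ) :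
    ∑ z ∈ ball y₀ ρ, ‖g z‖ ≤ Real.sqrt ((2 * ρ + 1 : ℝ) ^ P.d) * Real.sqrt (∑ z ∈ ball y₀ ρ, ‖g z‖ ^ 2) := by
  classical
  have h := cs_ball_const y₀ ρ (fun z => if supDist y₀ z ≤ ρ then (1 : ℝ) else 0) g zero_le_one
    (fun z => by split_ifs <;> simp) (fun z hz => by simp only [if_neg (not_le.2 hz)])
  rw [one_mul] at h
  have e : ∑ z ∈ ball y₀ ρ, ‖g z‖ = ∑ z, (if supDist y₀ z ≤ ρ then (1 : ℝ) else 0) * ‖g z‖ := by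
    simp only [ite_mul, one_mul, zero_mul, ball, Finset.sum_filter]
  rw [e]; exact h

/-- kernel: `‖χ(z)·v‖ ≤ ‖v‖` (`0 ≤ χ ≤ 1`). [folklore] -/
private theorem norm_chi_mul_le {r : ℕ} (hr : 1 ≤ r) (y₀ z : Balaban1983to89.Site P 0) (v : ℂ) :
    ‖((chi y₀ r z : ℝ) : ℂ) * v‖ ≤ ‖v‖ := by
  rw [norm_mul, Complex.norm_real, Real.norm_of_nonneg (chi_nonneg y₀ r z)]
  exact mul_le_of_le_one_left (norm_nonneg _) (chi_le_one hr y₀ z)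

/-- **THE BLOCK (`Q_k^*Q_k`) PART OF THE COMMUTATOR**: with `‖K‖ ≤ A₀/max(T,1)^{d−1}`,
`‖Σ_z a′(χ(z)(Q_1ᴴQ_1K)(z) − (Q_1ᴴQ_1(χK))(z))ψ(z)‖ ≤ 2a′ν_kA₀(1 + 2d3^{d−1}(2r+2L^k))·√((2(2r+L^k)+1)^d)·√(Σ_{T≤2r+L^k}‖ψ‖²)` — both
Gram terms are block sums of `‖K‖` (weights `ν_k = N⁻²`), nonzero only for `T(z) ≤ 2r + L^k`, where the block lies in the ball `T ≤ 2r + 2L^k`.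
[cite: BalabanImbrieJaffe1985, (4.6.2) p.313, p.326] -/
theorem commQ_le {k : ℕ} (hk : k ≤ P.m + P.K) {r : ℕ} (hr : 1 ≤ r) (y₀ : Balaban1983to89.Site P 0)
    (K ψ : Balaban1983to89.Site P 0 → ℂ) {A₀ a' : ℝ} (hA₀ : 0 ≤ A₀) (ha' : 0 ≤ a')
    (hK0 : ∀ z, ‖K z‖ ≤ A₀ / (max (supDist y₀ z : ℝ) 1) ^ (P.d - 1)) :
    ‖∑ z : Balaban1983to89.Site P 0, ((a' : ℂ) * (((chi y₀ r z : ℝ) : ℂ) *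
        ((((qMatK (1 : GaugeField P 0 U1) k univ)ᴴ * qMatK (1 : GaugeField P 0 U1) k univ)) *ᵥ K) z -
        ((((qMatK (1 : GaugeField P 0 U1) k univ)ᴴ * qMatK (1 : GaugeField P 0 U1) k univ)) *ᵥ
          fun w => ((chi y₀ r w : ℝ) : ℂ) * K w) z)) * ψ z‖ ≤
      2 * a' * (((P.L : ℝ) ^ (k * P.d))⁻¹ * (((P.L : ℝ) ^ P.d)⁻¹) ^ k) * (A₀ * (1 + 2 * P.d * 3 ^ (P.d - 1) * (2 * r + 2 * P.L ^ k : ℕ))) *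
        Real.sqrt ((2 * (2 * r + P.L ^ k : ℕ) + 1 : ℝ) ^ P.d) * Real.sqrt (∑ z ∈ ball y₀ (2 * r + P.L ^ k), ‖ψ z‖ ^ 2) := by
  classical
  set Q1 := (qMatK (1 : GaugeField P 0 U1) k univ)ᴴ * qMatK (1 : GaugeField P 0 U1) k univ with hQ1
  set νk : ℝ := ((P.L : ℝ) ^ (k * P.d))⁻¹ * (((P.L : ℝ) ^ P.d)⁻¹) ^ k with hνk
  have hνk0 : 0 ≤ νk := by positivity
  set M : ℝ := A₀ * (1 + 2 * P.d * 3 ^ (P.d - 1) * (2 * r + 2 * P.L ^ k : ℕ)) with hM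
  have hM0 : 0 ≤ M := by positivity
  -- the weight and its support
  set a : Balaban1983to89.Site P 0 → ℝ := fun z =>
    a' * ‖((chi y₀ r z : ℝ) : ℂ) * (Q1 *ᵥ K) z - (Q1 *ᵥ fun w => ((chi y₀ r w : ℝ) : ℂ) * K w) z‖ with ha
  have hχK : ∀ w, ‖((chi y₀ r w : ℝ) : ℂ) * K w‖ ≤ ‖K w‖ := fun w => norm_chi_mul_le hr y₀ w (K w)
  have hblock : ∀ z, supDist y₀ z ≤ 2 * r + P.L ^ k → ∑ z' ∈ blockK k (blkIter k z), ‖K z'‖ ≤ M := by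
    intro z hz
    have hsub := blockK_subset_ball hk hz
    refine (Finset.sum_le_sum_of_subset_of_nonneg hsub fun _ _ _ => norm_nonneg _).trans ?_
    rw [show 2 * r + P.L ^ k + P.L ^ k = 2 * r + 2 * P.L ^ k by ring]
    exact sum_ball_norm_le y₀ _ hA₀ K hK0
  -- off the ball `T ≤ 2r + L^k` the weight vanishes
  have hout : ∀ z, 2 * r + P.L ^ k < supDist y₀ z → a z = 0 := by
    intro z hz
    have hχ0 : chi y₀ r z = 0 := by
      by_contra h; have := supDist_lt_of_chi_ne_zero hr h; omega
    have hQ0 : (Q1 *ᵥ fun w => ((chi y₀ r w : ℝ) : ℂ) * K w) z = 0 := by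
      have hb := gram_le hk (1 : GaugeField P 0 U1) (fun w => ((chi y₀ r w : ℝ) : ℂ) * K w) z
      have hzero : ∑ z' ∈ blockK k (blkIter k z), ‖((chi y₀ r z' : ℝ) : ℂ) * K z'‖ = 0 := by
        refine Finset.sum_eq_zero fun z' hz' => ?_
        have h1 : supDist z z' ≤ P.L ^ k :=
          BIJ85ScalarPropagatorSupDecayDeriv.supDist_le_of_blkIter_eq' hk ((mem_blockK.1 hz').symm)
        have h2 := supDist_triangle y₀ z' z
        rw [supDist_comm z' z] at h2
        have hχ' : chi y₀ r z' = 0 := by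
          by_contra h; have := supDist_lt_of_chi_ne_zero hr h; omega
        rw [hχ', Complex.ofReal_zero, zero_mul, norm_zero]
      rw [hzero, mul_zero] at hb
      exact norm_le_zero_iff.1 hb
    rw [ha]; simp only
    rw [hχ0, hQ0, Complex.ofReal_zero, zero_mul, sub_zero, norm_zero, mul_zero]
  -- on the ball it is at most the constant `2a′ν_kM`
  have hbd : ∀ z, |a z| ≤ 2 * a' * νk * M := by
    intro z
    rw [ha]; simp only; rw [abs_of_nonneg (mul_nonneg ha' (norm_nonneg _))]
    by_cases hz : supDist y₀ z ≤ 2 * r + P.L ^ k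
    · have h1 : ‖(Q1 *ᵥ K) z‖ ≤ νk * M := by
        refine (gram_le hk (1 : GaugeField P 0 U1) K z).trans ?_
        rw [hνk]; exact mul_le_mul_of_nonneg_left (hblock z hz) hνk0
      have h2 : ‖(Q1 *ᵥ fun w => ((chi y₀ r w : ℝ) : ℂ) * K w) z‖ ≤ νk * M := by
        refine (gram_le hk (1 : GaugeField P 0 U1) _ z).trans ?_
        rw [hνk]
        refine mul_le_mul_of_nonneg_left ((Finset.sum_le_sum fun w _ => hχK w).trans (hblock z hz)) hνk0
      have h3 : ‖((chi y₀ r z : ℝ) : ℂ) * (Q1 *ᵥ K) z - (Q1 *ᵥ fun w => ((chi y₀ r w : ℝ) : ℂ) * K w) z‖ ≤ νk * M + νk * M := by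
        exact (norm_sub_le _ _).trans (add_le_add ((norm_chi_mul_le hr y₀ z _).trans h1) h2)
      calc a' * ‖((chi y₀ r z : ℝ) : ℂ) * (Q1 *ᵥ K) z - (Q1 *ᵥ fun w => ((chi y₀ r w : ℝ) : ℂ) * K w) z‖
          ≤ a' * (νk * M + νk * M) := mul_le_mul_of_nonneg_left h3 ha'
        _ = 2 * a' * νk * M := by ring
    · have := hout z (not_le.1 hz)
      rw [ha] at this; simp only at this
      rw [this]; positivity
  have hS := cs_ball_const y₀ (2 * r + P.L ^ k) a ψ (by positivity : 0 ≤ 2 * a' * νk * M) hbd hout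
  calc _ ≤ ∑ z, ‖((a' : ℂ) * (((chi y₀ r z : ℝ) : ℂ) * (Q1 *ᵥ K) z - (Q1 *ᵥ fun w => ((chi y₀ r w : ℝ) : ℂ) * K w) z)) * ψ z‖ :=
        norm_sum_le _ _
    _ = ∑ z, a z * ‖ψ z‖ := sum_congr rfl fun z _ => by
        rw [norm_mul, norm_mul, Complex.norm_real, Real.norm_of_nonneg ha']
    _ ≤ _ := hS

/-- **THE LAPLACIAN PART OF THE PERTURBATION, ONE DIRECTION** (`d ≤ 3`; the `W`-sum after the per-bond identity, `K̃ = χK`): with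
`|u| = 1`, `|u_{z,μ} − 1| ≤ γ|y₀ − z|_∞` on `T ≤ 2r` and the two kernel envelopes,
`‖Σ_z((ū−1)K̃(z)(uψ(z+e_μ) − ψ(z)) + (1−ū)(K̃(z+e_μ) − K̃(z))ψ(z))‖ ≤ γ√(2d3^{d−1}(2r)^{4−d})·(A₀W_μ + (2^{d−1}A₀/r + A₁)E)` — both weights
are `≲ γT/max(T,1)^{d−1}` on the ball `T ≤ 2r` (the radial square profile of §3). [cite: BalabanImbrieJaffe1985, (4.6.3) p.313, p.326] -/
theorem pertD_dir_le (hd3 : P.d ≤ 3) {r : ℕ} (hr : 1 ≤ r) (hN : 4 * r + 6 ≤ P.sitesPerDir 0) (y₀ : Balaban1983to89.Site P 0)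
    (K ψ : Balaban1983to89.Site P 0 → ℂ) (u : PBond P 0 → ℂ)
    {A₀ A₁ γ : ℝ} (hA₀ : 0 ≤ A₀) (hA₁ : 0 ≤ A₁) (hγ : 0 ≤ γ)
    (hK0 : ∀ z, ‖K z‖ ≤ A₀ / (max (supDist y₀ z : ℝ) 1) ^ (P.d - 1))
    (hK1 : ∀ z (ν : Fin P.d), ‖K (z.shift ν) - K z‖ ≤ A₁ / (max (supDist y₀ z : ℝ) 1) ^ (P.d - 1))
    (hu : ∀ z (μ : Fin P.d), supDist y₀ z ≤ 2 * r → ‖u ⟨z, μ⟩ - 1‖ ≤ γ * supDist y₀ z) (μ : Fin P.d) :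
    ‖∑ z : Balaban1983to89.Site P 0,
        ((conj (u ⟨z, μ⟩) - 1) * (((chi y₀ r z : ℝ) : ℂ) * K z) * (u ⟨z, μ⟩ * ψ (z.shift μ) - ψ z) +
          (1 - conj (u ⟨z, μ⟩)) * ((((chi y₀ r (z.shift μ) : ℝ) : ℂ) * K (z.shift μ)) - (((chi y₀ r z : ℝ) : ℂ) * K z)) * ψ z)‖ ≤
      γ * Real.sqrt (2 * P.d * 3 ^ (P.d - 1) * ((2 * r : ℕ) : ℝ) ^ (4 - P.d)) *
        (A₀ * Real.sqrt (∑ z ∈ ball y₀ (2 * r), ‖u ⟨z, μ⟩ * ψ (z.shift μ) - ψ z‖ ^ 2) +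
          (2 ^ (P.d - 1) * A₀ / r + A₁) * Real.sqrt (∑ z ∈ ball y₀ (2 * r), ‖ψ z‖ ^ 2)) := by
  have hr0 : (0 : ℝ) < r := by exact_mod_cast hr
  set S := Real.sqrt (2 * P.d * 3 ^ (P.d - 1) * ((2 * r : ℕ) : ℝ) ^ (4 - P.d)) with hS
  set E := Real.sqrt (∑ z ∈ ball y₀ (2 * r), ‖ψ z‖ ^ 2) with hE
  set Wμ := Real.sqrt (∑ z ∈ ball y₀ (2 * r), ‖u ⟨z, μ⟩ * ψ (z.shift μ) - ψ z‖ ^ 2) with hW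
  -- the two weights
  set b₁ : Balaban1983to89.Site P 0 → ℝ := fun z => ‖u ⟨z, μ⟩ - 1‖ * (chi y₀ r z * ‖K z‖) with hb₁
  set b₂ : Balaban1983to89.Site P 0 → ℝ := fun z =>
    ‖u ⟨z, μ⟩ - 1‖ * ‖(((chi y₀ r (z.shift μ) : ℝ) : ℂ) * K (z.shift μ)) - (((chi y₀ r z : ℝ) : ℂ) * K z)‖ with hb₂
  have hχ0 := fun z => chi_nonneg y₀ r z
  have hχ1 := fun z => chi_le_one hr y₀ z
  have hchi_out : ∀ z, 2 * r ≤ supDist y₀ z → chi y₀ r z = 0 := by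
    intro z hz; by_contra h; have := supDist_lt_of_chi_ne_zero hr h; omega
  -- profile bounds
  have hB₁ : ∀ z, supDist y₀ z ≤ 2 * r → |b₁ z| ≤ γ * A₀ * (supDist y₀ z : ℝ) / (max (supDist y₀ z : ℝ) 1) ^ (P.d - 1) := by
    intro z hz
    rw [hb₁]; simp only
    rw [abs_of_nonneg (mul_nonneg (norm_nonneg _) (mul_nonneg (hχ0 z) (norm_nonneg _)))]
    calc ‖u ⟨z, μ⟩ - 1‖ * (chi y₀ r z * ‖K z‖) ≤ (γ * supDist y₀ z) * (1 * (A₀ / (max (supDist y₀ z : ℝ) 1) ^ (P.d - 1))) :=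
          mul_le_mul (hu z μ hz) (mul_le_mul (hχ1 z) (hK0 z) (norm_nonneg _) zero_le_one)
            (mul_nonneg (hχ0 z) (norm_nonneg _)) (by positivity)
      _ = _ := by ring
  have hO₁ : ∀ z, 2 * r < supDist y₀ z → b₁ z = 0 := by
    intro z hz; rw [hb₁]; simp only; rw [hchi_out z hz.le, zero_mul, mul_zero]
  have hB₂ : ∀ z, supDist y₀ z ≤ 2 * r →
      |b₂ z| ≤ γ * (2 ^ (P.d - 1) * A₀ / r + A₁) * (supDist y₀ z : ℝ) / (max (supDist y₀ z : ℝ) 1) ^ (P.d - 1) := by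
    intro z hz
    rw [hb₂]; simp only
    rw [abs_of_nonneg (mul_nonneg (norm_nonneg _) (norm_nonneg _))]
    have hsplit : (((chi y₀ r (z.shift μ) : ℝ) : ℂ) * K (z.shift μ)) - (((chi y₀ r z : ℝ) : ℂ) * K z) =
        (((chi y₀ r (z.shift μ) : ℝ) : ℂ) - ((chi y₀ r z : ℝ) : ℂ)) * K (z.shift μ) + ((chi y₀ r z : ℝ) : ℂ) * (K (z.shift μ) - K z) := by
      ring
    have hKs : ‖K (z.shift μ)‖ ≤ 2 ^ (P.d - 1) * A₀ / (max (supDist y₀ z : ℝ) 1) ^ (P.d - 1) :=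
      (hK0 (z.shift μ)).trans (env_neighbour (supDist_le_shift_succ y₀ z μ) _ hA₀)
    have h3 : ‖(((chi y₀ r (z.shift μ) : ℝ) : ℂ) * K (z.shift μ)) - (((chi y₀ r z : ℝ) : ℂ) * K z)‖ ≤
        1 / r * (2 ^ (P.d - 1) * A₀ / (max (supDist y₀ z : ℝ) 1) ^ (P.d - 1)) + 1 * (A₁ / (max (supDist y₀ z : ℝ) 1) ^ (P.d - 1)) := by
      rw [hsplit]
      refine (norm_add_le _ _).trans (add_le_add ?_ ?_)
      · rw [norm_mul, ← Complex.ofReal_sub, Complex.norm_real, Real.norm_eq_abs]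
        exact mul_le_mul (abs_chi_shift_sub_le hr hN y₀ z μ) hKs (norm_nonneg _) (by positivity)
      · rw [norm_mul, Complex.norm_real, Real.norm_of_nonneg (hχ0 z)]
        exact mul_le_mul (hχ1 z) (hK1 z μ) (norm_nonneg _) zero_le_one
    calc ‖u ⟨z, μ⟩ - 1‖ * ‖(((chi y₀ r (z.shift μ) : ℝ) : ℂ) * K (z.shift μ)) - (((chi y₀ r z : ℝ) : ℂ) * K z)‖
        ≤ (γ * supDist y₀ z) * (1 / r * (2 ^ (P.d - 1) * A₀ / (max (supDist y₀ z : ℝ) 1) ^ (P.d - 1)) +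
            1 * (A₁ / (max (supDist y₀ z : ℝ) 1) ^ (P.d - 1))) :=
          mul_le_mul (hu z μ hz) h3 (norm_nonneg _) (by positivity)
      _ = _ := by field_simp
  have hO₂ : ∀ z, 2 * r < supDist y₀ z → b₂ z = 0 := by
    intro z hz
    have h1 : chi y₀ r z = 0 := hchi_out z hz.le
    have h2 : chi y₀ r (z.shift μ) = 0 := by
      refine hchi_out (z.shift μ) ?_
      have := supDist_le_shift_succ y₀ z μ; omega
    rw [hb₂]; simp only; rw [h1, h2, Complex.ofReal_zero, zero_mul, zero_mul, sub_zero, norm_zero, mul_zero]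
  have hS₁ := cs_ball_T hd3 y₀ (2 * r) b₁ (fun z => u ⟨z, μ⟩ * ψ (z.shift μ) - ψ z) (by positivity : 0 ≤ γ * A₀) hB₁ hO₁
  have hS₂ := cs_ball_T hd3 y₀ (2 * r) b₂ ψ (by positivity : 0 ≤ γ * (2 ^ (P.d - 1) * A₀ / r + A₁)) hB₂ hO₂
  -- pointwise splitting
  have hpt : ∀ z, ‖(conj (u ⟨z, μ⟩) - 1) * (((chi y₀ r z : ℝ) : ℂ) * K z) * (u ⟨z, μ⟩ * ψ (z.shift μ) - ψ z) +
      (1 - conj (u ⟨z, μ⟩)) * ((((chi y₀ r (z.shift μ) : ℝ) : ℂ) * K (z.shift μ)) - (((chi y₀ r z : ℝ) : ℂ) * K z)) * ψ z‖ ≤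
      b₁ z * ‖u ⟨z, μ⟩ * ψ (z.shift μ) - ψ z‖ + b₂ z * ‖ψ z‖ := by
    intro z
    have hn1 : ‖conj (u ⟨z, μ⟩) - 1‖ = ‖u ⟨z, μ⟩ - 1‖ := by
      rw [← Complex.norm_conj, map_sub, Complex.conj_conj, map_one]
    have hn2 : ‖1 - conj (u ⟨z, μ⟩)‖ = ‖u ⟨z, μ⟩ - 1‖ := by rw [norm_sub_rev, hn1]
    refine (norm_add_le _ _).trans (le_of_eq ?_)
    rw [norm_mul, norm_mul, norm_mul, norm_mul, norm_mul, hn1, hn2, Complex.norm_real, Real.norm_of_nonneg (hχ0 z), hb₁, hb₂]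
  calc _ ≤ ∑ z, (b₁ z * ‖u ⟨z, μ⟩ * ψ (z.shift μ) - ψ z‖ + b₂ z * ‖ψ z‖) := (norm_sum_le _ _).trans (sum_le_sum fun z _ => hpt z)
    _ = ∑ z, b₁ z * ‖u ⟨z, μ⟩ * ψ (z.shift μ) - ψ z‖ + ∑ z, b₂ z * ‖ψ z‖ := sum_add_distrib
    _ ≤ γ * A₀ * S * Wμ + γ * (2 ^ (P.d - 1) * A₀ / r + A₁) * S * E := add_le_add hS₁ hS₂
    _ = γ * S * (A₀ * Wμ + (2 ^ (P.d - 1) * A₀ / r + A₁) * E) := by ring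

/-- **THE BLOCK (`Q_k^*Q_k`) PART OF THE PERTURBATION** (no cancellation used; `K̃ = χK`, `|u(Γ)| = 1`):
`‖Σ_z K̃(z)·a′((Q_uᴴQ_uψ)(z) − (Q_1ᴴQ_1ψ)(z))‖ ≤ 2a′ν_kA₀(1 + 2d3^{d−1}·2r)·√((2(2r+L^k)+1)^d)·√(Σ_{T≤2r+L^k}‖ψ‖²)` — each Gram term is a block
sum of `‖ψ‖` over a block inside the ball `T ≤ 2r + L^k`, against the kernel mass `Σ_{T≤2r}‖K‖`. [cite: BalabanImbrieJaffe1985, (2.6) p.303, (4.6.2) p.313] -/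
theorem pertQ_le {k : ℕ} (hk : k ≤ P.m + P.K) {r : ℕ} (hr : 1 ≤ r) (y₀ : Balaban1983to89.Site P 0) (U : GaugeField P 0 U1)
    (K ψ : Balaban1983to89.Site P 0 → ℂ) {A₀ a' : ℝ} (hA₀ : 0 ≤ A₀) (ha' : 0 ≤ a')
    (hK0 : ∀ z, ‖K z‖ ≤ A₀ / (max (supDist y₀ z : ℝ) 1) ^ (P.d - 1)) :
    ‖∑ z : Balaban1983to89.Site P 0, (((chi y₀ r z : ℝ) : ℂ) * K z) * ((a' : ℂ) *
        (((((qMatK U k univ)ᴴ * qMatK U k univ)) *ᵥ ψ) z -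
          ((((qMatK (1 : GaugeField P 0 U1) k univ)ᴴ * qMatK (1 : GaugeField P 0 U1) k univ)) *ᵥ ψ) z))‖ ≤
      2 * a' * (((P.L : ℝ) ^ (k * P.d))⁻¹ * (((P.L : ℝ) ^ P.d)⁻¹) ^ k) * (A₀ * (1 + 2 * P.d * 3 ^ (P.d - 1) * (2 * r : ℕ))) *
        Real.sqrt ((2 * (2 * r + P.L ^ k : ℕ) + 1 : ℝ) ^ P.d) * Real.sqrt (∑ z ∈ ball y₀ (2 * r + P.L ^ k), ‖ψ z‖ ^ 2) := by
  classical
  set Qu := (qMatK U k univ)ᴴ * qMatK U k univ with hQu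
  set Q1 := (qMatK (1 : GaugeField P 0 U1) k univ)ᴴ * qMatK (1 : GaugeField P 0 U1) k univ with hQ1
  set νk : ℝ := ((P.L : ℝ) ^ (k * P.d))⁻¹ * (((P.L : ℝ) ^ P.d)⁻¹) ^ k with hνk
  have hνk0 : 0 ≤ νk := by positivity
  set Ψ : ℝ := Real.sqrt ((2 * (2 * r + P.L ^ k : ℕ) + 1 : ℝ) ^ P.d) * Real.sqrt (∑ z ∈ ball y₀ (2 * r + P.L ^ k), ‖ψ z‖ ^ 2) with hΨ
  have hΨ0 : 0 ≤ Ψ := by positivity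
  have hχ0 := fun z => chi_nonneg y₀ r z
  have hχ1 := fun z => chi_le_one hr y₀ z
  -- the block sums of `‖ψ‖` inside the support of `χ`
  have hblock : ∀ z, chi y₀ r z ≠ 0 → ∑ z' ∈ blockK k (blkIter k z), ‖ψ z'‖ ≤ Ψ := by
    intro z hz
    have hT : supDist y₀ z ≤ 2 * r := (supDist_lt_of_chi_ne_zero hr hz).le
    refine (Finset.sum_le_sum_of_subset_of_nonneg (blockK_subset_ball hk hT) fun _ _ _ => norm_nonneg _).trans ?_
    exact sum_ball_norm_le_sqrt y₀ _ ψ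
  -- pointwise
  have hpt : ∀ z, ‖(((chi y₀ r z : ℝ) : ℂ) * K z) * ((a' : ℂ) * ((Qu *ᵥ ψ) z - (Q1 *ᵥ ψ) z))‖ ≤
      (chi y₀ r z * ‖K z‖) * (2 * a' * νk * Ψ) := by
    intro z
    rw [norm_mul, norm_mul, norm_mul, Complex.norm_real, Real.norm_of_nonneg (hχ0 z), Complex.norm_real, Real.norm_of_nonneg ha']
    by_cases hz : chi y₀ r z = 0
    · rw [hz]; simp
    · refine mul_le_mul_of_nonneg_left ?_ (mul_nonneg (hχ0 z) (norm_nonneg _))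
      have h1 : ‖(Qu *ᵥ ψ) z‖ ≤ νk * Ψ := by
        refine (gram_le hk U ψ z).trans ?_
        rw [hνk]; exact mul_le_mul_of_nonneg_left (hblock z hz) hνk0
      have h2 : ‖(Q1 *ᵥ ψ) z‖ ≤ νk * Ψ := by
        refine (gram_le hk (1 : GaugeField P 0 U1) ψ z).trans ?_
        rw [hνk]; exact mul_le_mul_of_nonneg_left (hblock z hz) hνk0
      calc a' * ‖(Qu *ᵥ ψ) z - (Q1 *ᵥ ψ) z‖ ≤ a' * (νk * Ψ + νk * Ψ) :=
            mul_le_mul_of_nonneg_left ((norm_sub_le _ _).trans (add_le_add h1 h2)) ha'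
        _ = 2 * a' * νk * Ψ := by ring
  -- the kernel mass
  have hmass : ∑ z, chi y₀ r z * ‖K z‖ ≤ A₀ * (1 + 2 * P.d * 3 ^ (P.d - 1) * (2 * r : ℕ)) := by
    have e : ∑ z, chi y₀ r z * ‖K z‖ = ∑ z ∈ ball y₀ (2 * r), chi y₀ r z * ‖K z‖ := by
      refine (Finset.sum_subset (Finset.subset_univ _) fun z _ hz => ?_).symm
      rw [mem_ball, not_le] at hz
      have : chi y₀ r z = 0 := by
        by_contra h; have := supDist_lt_of_chi_ne_zero hr h; omega
      rw [this, zero_mul]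
    rw [e]
    refine (sum_le_sum fun z _ => mul_le_of_le_one_left (norm_nonneg _) (hχ1 z)).trans ?_
    exact sum_ball_norm_le y₀ _ hA₀ K hK0
  calc _ ≤ ∑ z, (chi y₀ r z * ‖K z‖) * (2 * a' * νk * Ψ) := (norm_sum_le _ _).trans (sum_le_sum fun z _ => hpt z)
    _ = (∑ z, chi y₀ r z * ‖K z‖) * (2 * a' * νk * Ψ) := by rw [sum_mul]
    _ ≤ A₀ * (1 + 2 * P.d * 3 ^ (P.d - 1) * (2 * r : ℕ)) * (2 * a' * νk * Ψ) :=
        mul_le_mul_of_nonneg_right hmass (by positivity)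
    _ = _ := by rw [hΨ]; ring

end Terms

/-! ## §5 THE LOCAL MEAN-VALUE INEQUALITY for `N(u)`-harmonic functions, in a gauge with linear growth from the centre -/

section MeanValue

variable {P : Params}

open BIJ85BlockAveragesTorus BIJ85BlockAveragesTorusK

/-- **THE LOCAL MEAN-VALUE INEQUALITY, ABSTRACT KERNEL ENVELOPES** (`d ≤ 3`, `r ≥ 2`, `4r + 6 ≤` sites per direction): for the
whole-torus operator `N(u) = ε^{−2}D_u^*D_u + a′Q_k(u)ᴴQ_k(u)` (`a′ = α_kL^{kd}`), a function `ψ` with `(N(u)ψ)(z) = 0` on the ball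
`|y₀ − z|_∞ ≤ 2r`, a field with `|u_{z,μ} − 1| ≤ γ|y₀ − z|_∞` there, and envelopes `‖G♭(y₀,z)‖ ≤ A₀/max(T,1)^{d−1}`,
`‖G♭(y₀,z+e_ν) − G♭(y₀,z)‖ ≤ A₁/max(T,1)^{d−1}` of the FLAT propagator row: `‖ψ(y₀)‖ ≤` the sum of the four `ℓ²` term bounds of §4
(`E = √(Σ_{T≤2r}‖ψ‖²)`, `W = √(Σ_{T≤2r}Σ_μ‖u_{z,μ}ψ(z+e_μ) − ψ(z)‖²)`, `E₂ = √(Σ_{T≤2r+L^k}‖ψ‖²)`, `ν_k = N⁻²`) — the localized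
representation `ψ(y₀) = −Σ G♭χ(N(u) − N♭)ψ + Σ((χN♭ − N♭χ)G♭)ψ` of §2 (the source term vanishes on the support of `χ`).
[cite: BalabanImbrieJaffe1985, (4.6.2) p.313, p.326] [cite: Balaban1983RegularityDecay, Theorem p.573 (1.10)] -/
theorem local_meanValue_abstract (hd3 : P.d ≤ 3) {a : ℝ} (ha : 0 < a) {k : ℕ} (hk1 : 1 ≤ k) (hk : k ≤ P.m + P.K)
    {r : ℕ} (hr : 2 ≤ r) (hN : 4 * r + 6 ≤ P.sitesPerDir 0) (y₀ : Balaban1983to89.Site P 0) (U : GaugeField P 0 U1)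
    (ψ : Balaban1983to89.Site P 0 → ℂ)
    (hψ : ∀ z, supDist y₀ z ≤ 2 * r → (nOp (B1RG242Torus.α P a k * (P.L : ℝ) ^ (k * P.d)) P.eps⁻¹ U k univ *ᵥ ψ) z = 0)
    {A₀ A₁ γ : ℝ} (hA₀ : 0 ≤ A₀) (hA₁ : 0 ≤ A₁) (hγ : 0 ≤ γ)
    (hK0 : ∀ z, ‖gBox (B1RG242Torus.α P a k * (P.L : ℝ) ^ (k * P.d)) P.eps⁻¹ (1 : GaugeField P 0 U1) k univ y₀ z‖ ≤
      A₀ / (max (supDist y₀ z : ℝ) 1) ^ (P.d - 1))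
    (hK1 : ∀ z (ν : Fin P.d), ‖gBox (B1RG242Torus.α P a k * (P.L : ℝ) ^ (k * P.d)) P.eps⁻¹ (1 : GaugeField P 0 U1) k univ y₀ (z.shift ν) -
        gBox (B1RG242Torus.α P a k * (P.L : ℝ) ^ (k * P.d)) P.eps⁻¹ (1 : GaugeField P 0 U1) k univ y₀ z‖ ≤
      A₁ / (max (supDist y₀ z : ℝ) 1) ^ (P.d - 1))
    (hu : ∀ z (μ : Fin P.d), supDist y₀ z ≤ 2 * r → ‖cfg U ⟨z, μ⟩ - 1‖ ≤ γ * supDist y₀ z) :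
    ‖ψ y₀‖ ≤
      P.eps⁻¹ ^ 2 *
          (P.d * ((2 / (r : ℝ)) ^ (P.d - 1) / r * Real.sqrt ((2 * (2 * (r : ℝ)) + 1) ^ P.d) *
              (A₁ * Real.sqrt (∑ z ∈ ball y₀ (2 * r), ‖ψ z‖ ^ 2) +
                A₀ * Real.sqrt (∑ z ∈ ball y₀ (2 * r), ∑ μ : Fin P.d, ‖cfg U ⟨z, μ⟩ * ψ (z.shift μ) - ψ z‖ ^ 2) +
                2 * γ * r * A₀ * Real.sqrt (∑ z ∈ ball y₀ (2 * r), ‖ψ z‖ ^ 2))) +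
            P.d * (γ * Real.sqrt (2 * P.d * 3 ^ (P.d - 1) * (2 * (r : ℝ)) ^ (4 - P.d)) *
              (A₀ * Real.sqrt (∑ z ∈ ball y₀ (2 * r), ∑ μ : Fin P.d, ‖cfg U ⟨z, μ⟩ * ψ (z.shift μ) - ψ z‖ ^ 2) +
                (2 ^ (P.d - 1) * A₀ / r + A₁) * Real.sqrt (∑ z ∈ ball y₀ (2 * r), ‖ψ z‖ ^ 2)))) +
        2 * (B1RG242Torus.α P a k * (P.L : ℝ) ^ (k * P.d)) * (((P.L : ℝ) ^ (k * P.d))⁻¹ * (((P.L : ℝ) ^ P.d)⁻¹) ^ k) *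
            (A₀ * (1 + 2 * P.d * 3 ^ (P.d - 1) * (2 * (r : ℝ) + 2 * (P.L : ℝ) ^ k))) *
          Real.sqrt ((2 * (2 * (r : ℝ) + (P.L : ℝ) ^ k) + 1) ^ P.d) * Real.sqrt (∑ z ∈ ball y₀ (2 * r + P.L ^ k), ‖ψ z‖ ^ 2) +
        2 * (B1RG242Torus.α P a k * (P.L : ℝ) ^ (k * P.d)) * (((P.L : ℝ) ^ (k * P.d))⁻¹ * (((P.L : ℝ) ^ P.d)⁻¹) ^ k) *
            (A₀ * (1 + 2 * P.d * 3 ^ (P.d - 1) * (2 * (r : ℝ)))) *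
          Real.sqrt ((2 * (2 * (r : ℝ) + (P.L : ℝ) ^ k) + 1) ^ P.d) * Real.sqrt (∑ z ∈ ball y₀ (2 * r + P.L ^ k), ‖ψ z‖ ^ 2) := by
  have hr1 : 1 ≤ r := by omega
  set a' : ℝ := B1RG242Torus.α P a k * (P.L : ℝ) ^ (k * P.d) with ha'def
  have hα : 0 < B1RG242Torus.α P a k :=
    mul_pos (B1.aSeq_pos ha (B1RG242Torus.one_lt_cast_L P) hk1) (inv_pos.2 (pow_pos (P.spacing_pos k) 2))
  have ha' : 0 < a' := mul_pos hα (pow_pos P.cast_L_pos _)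
  set Gf := gBox a' P.eps⁻¹ (1 : GaugeField P 0 U1) k univ with hGf
  set Nf := nOp a' P.eps⁻¹ (1 : GaugeField P 0 U1) k univ with hNf
  set N' := nOp a' P.eps⁻¹ U k univ with hN'
  set Q1 := (qMatK (1 : GaugeField P 0 U1) k univ)ᴴ * qMatK (1 : GaugeField P 0 U1) k univ with hQ1
  set Qu := (qMatK U k univ)ᴴ * qMatK U k univ with hQu
  set K : Balaban1983to89.Site P 0 → ℂ := fun z => Gf y₀ z with hK
  set χc : Balaban1983to89.Site P 0 → ℂ := fun z => ((chi y₀ r z : ℝ) : ℂ) with hχc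
  set u : PBond P 0 → ℂ := cfg U with hudef
  have hu1 : ∀ b, conj (u b) * u b = 1 := fun b => conj_mul_toC (U b)
  have hun : ∀ b, ‖u b‖ = 1 := fun b => norm_toC (U b)
  set E := Real.sqrt (∑ z ∈ ball y₀ (2 * r), ‖ψ z‖ ^ 2) with hE
  set W := Real.sqrt (∑ z ∈ ball y₀ (2 * r), ∑ μ : Fin P.d, ‖cfg U ⟨z, μ⟩ * ψ (z.shift μ) - ψ z‖ ^ 2) with hW
  set E₂ := Real.sqrt (∑ z ∈ ball y₀ (2 * r + P.L ^ k), ‖ψ z‖ ^ 2) with hE₂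
  -- the cutoff is `1` at the centre and vanishes off `T < 2r`
  have hχ0 : χc y₀ = 1 := by
    rw [hχc]; simp only
    rw [chi_eq_one_of_supDist_le (by rw [(supDist_eq_zero_iff y₀ y₀).2 rfl]; exact Nat.zero_le _), Complex.ofReal_one]
  have hχout : ∀ z, 2 * r ≤ supDist y₀ z → chi y₀ r z = 0 := by
    intro z hz; by_contra h; have := supDist_lt_of_chi_ne_zero hr1 h; omega
  -- (E) the representation
  have hrep := loc_representation_value ha hk1 hk U ψ χc y₀ hχ0
  -- the source term vanishes
  have hsrc : ∑ z, Gf y₀ z * (χc z * (N' *ᵥ ψ) z) = 0 := by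
    refine Finset.sum_eq_zero fun z _ => ?_
    by_cases hz : supDist y₀ z ≤ 2 * r
    · rw [hψ z hz, mul_zero, mul_zero]
    · rw [hχc]; simp only; rw [hχout z (by omega), Complex.ofReal_zero, zero_mul, mul_zero]
  -- the perturbation term, split into its Laplacian and block parts
  have hpert : ∑ z, Gf y₀ z * (χc z * ((N' - Nf) *ᵥ ψ) z) =
      (P.eps⁻¹ : ℂ) ^ 2 * ∑ z, (χc z * K z) * ∑ μ : Fin P.d,
          ((1 - u ⟨z, μ⟩) * ψ (z.shift μ) + (1 - conj (u ⟨z.unshift μ, μ⟩)) * ψ (z.unshift μ)) +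
        ∑ z, (χc z * K z) * ((a' : ℂ) * ((Qu *ᵥ ψ) z - (Q1 *ᵥ ψ) z)) := by
    rw [mul_sum, ← sum_add_distrib]
    refine sum_congr rfl fun z _ => ?_
    rw [hN', hNf, nOp_sub_flat_mulVec_apply, hK]
    simp only [Complex.ofReal_inv]
    ring
  -- the commutator term, split likewise
  have hcomm : ∑ z, ((diagonal χc * Nf - Nf * diagonal χc) *ᵥ K) z * ψ z =
      (P.eps⁻¹ : ℂ) ^ 2 * ∑ z, (∑ μ : Fin P.d,
          ((χc (z.shift μ) - χc z) * K (z.shift μ) + (χc (z.unshift μ) - χc z) * K (z.unshift μ))) * ψ z +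
        ∑ z, ((a' : ℂ) * (χc z * (Q1 *ᵥ K) z - (Q1 *ᵥ fun w => χc w * K w) z)) * ψ z := by
    rw [mul_sum, ← sum_add_distrib]
    refine sum_congr rfl fun z _ => ?_
    rw [hNf, commutator_flat_apply]
    simp only [Complex.ofReal_inv]
    ring
  -- the four bounds
  have hε2 : ‖(P.eps⁻¹ : ℂ) ^ 2‖ = P.eps⁻¹ ^ 2 := by
    rw [norm_pow, ← Complex.ofReal_inv, Complex.norm_real, Real.norm_of_nonneg (inv_nonneg.2 P.eps_pos.le)]
  have hPD : ‖∑ z, (χc z * K z) * ∑ μ : Fin P.d,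
      ((1 - u ⟨z, μ⟩) * ψ (z.shift μ) + (1 - conj (u ⟨z.unshift μ, μ⟩)) * ψ (z.unshift μ))‖ ≤
      P.d * (γ * Real.sqrt (2 * P.d * 3 ^ (P.d - 1) * ((2 * r : ℕ) : ℝ) ^ (4 - P.d)) *
        (A₀ * W + (2 ^ (P.d - 1) * A₀ / r + A₁) * E)) := by
    rw [W_sum_identity _ ψ u hu1]
    refine (norm_sum_le _ _).trans ?_
    have hμ : ∀ μ : Fin P.d, ‖∑ z : Balaban1983to89.Site P 0,
        ((conj (u ⟨z, μ⟩) - 1) * (χc z * K z) * (u ⟨z, μ⟩ * ψ (z.shift μ) - ψ z) +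
          (1 - conj (u ⟨z, μ⟩)) * ((χc (z.shift μ) * K (z.shift μ)) - (χc z * K z)) * ψ z)‖ ≤
        γ * Real.sqrt (2 * P.d * 3 ^ (P.d - 1) * ((2 * r : ℕ) : ℝ) ^ (4 - P.d)) *
          (A₀ * W + (2 ^ (P.d - 1) * A₀ / r + A₁) * E) := by
      intro μ
      refine (pertD_dir_le hd3 hr1 hN y₀ K ψ u hA₀ hA₁ hγ hK0 hK1 hu μ).trans ?_
      have hWμ := sqrt_dir_le y₀ (2 * r) (fun z ν => u ⟨z, ν⟩ * ψ (z.shift ν) - ψ z) μ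
      have hS0 : 0 ≤ γ * Real.sqrt (2 * P.d * 3 ^ (P.d - 1) * ((2 * r : ℕ) : ℝ) ^ (4 - P.d)) := by positivity
      refine mul_le_mul_of_nonneg_left (add_le_add (mul_le_mul_of_nonneg_left hWμ hA₀) le_rfl) hS0
    calc _ ≤ ∑ _μ : Fin P.d, γ * Real.sqrt (2 * P.d * 3 ^ (P.d - 1) * ((2 * r : ℕ) : ℝ) ^ (4 - P.d)) *
          (A₀ * W + (2 ^ (P.d - 1) * A₀ / r + A₁) * E) := sum_le_sum fun μ _ => hμ μ
      _ = _ := by rw [sum_const, card_univ, Fintype.card_fin, nsmul_eq_mul]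
  have hPQ := pertQ_le hk hr1 y₀ U K ψ hA₀ ha'.le hK0
  have hCD : ‖∑ z, (∑ μ : Fin P.d,
      ((χc (z.shift μ) - χc z) * K (z.shift μ) + (χc (z.unshift μ) - χc z) * K (z.unshift μ))) * ψ z‖ ≤
      P.d * ((2 / (r : ℝ)) ^ (P.d - 1) / r * Real.sqrt ((2 * (2 * r : ℕ) + 1 : ℝ) ^ P.d) *
        (A₁ * E + A₀ * W + 2 * γ * r * A₀ * E)) := by
    rw [commD_bond_form]
    refine (norm_sum_le _ _).trans ?_
    have hμ : ∀ μ : Fin P.d, ‖∑ z : Balaban1983to89.Site P 0, (χc (z.shift μ) - χc z) *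
        (K (z.shift μ) * ψ z - K z * ψ (z.shift μ))‖ ≤
        (2 / (r : ℝ)) ^ (P.d - 1) / r * Real.sqrt ((2 * (2 * r : ℕ) + 1 : ℝ) ^ P.d) * (A₁ * E + A₀ * W + 2 * γ * r * A₀ * E) := by
      intro μ
      refine (commD_dir_le hr hN y₀ K ψ u hu1 hun hA₀ hA₁ hγ hK0 hK1 hu μ).trans ?_
      have hWμ := sqrt_dir_le y₀ (2 * r) (fun z ν => u ⟨z, ν⟩ * ψ (z.shift ν) - ψ z) μ
      have hS0 : 0 ≤ (2 / (r : ℝ)) ^ (P.d - 1) / r * Real.sqrt ((2 * (2 * r : ℕ) + 1 : ℝ) ^ P.d) := by positivity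
      exact mul_le_mul_of_nonneg_left (add_le_add (add_le_add le_rfl (mul_le_mul_of_nonneg_left hWμ hA₀)) le_rfl) hS0
    calc _ ≤ ∑ _μ : Fin P.d, (2 / (r : ℝ)) ^ (P.d - 1) / r * Real.sqrt ((2 * (2 * r : ℕ) + 1 : ℝ) ^ P.d) *
          (A₁ * E + A₀ * W + 2 * γ * r * A₀ * E) := sum_le_sum fun μ _ => hμ μ
      _ = _ := by rw [sum_const, card_univ, Fintype.card_fin, nsmul_eq_mul]
  have hCQ := commQ_le hk hr1 y₀ K ψ hA₀ ha'.le hK0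
  -- casts of the radii
  have c1 : ((2 * r : ℕ) : ℝ) = 2 * (r : ℝ) := by push_cast; ring
  have c2 : ((2 * r + 2 * P.L ^ k : ℕ) : ℝ) = 2 * (r : ℝ) + 2 * (P.L : ℝ) ^ k := by push_cast; ring
  have c3 : ((2 * r + P.L ^ k : ℕ) : ℝ) = 2 * (r : ℝ) + (P.L : ℝ) ^ k := by push_cast; ring
  rw [c1] at hPD hCD hPQ
  rw [c2, c3] at hCQ
  rw [c3] at hPQ
  -- assemble
  rw [hrep, hsrc, zero_sub, hpert, hcomm]
  calc _ ≤ ‖-((P.eps⁻¹ : ℂ) ^ 2 * ∑ z, (χc z * K z) * ∑ μ : Fin P.d,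
            ((1 - u ⟨z, μ⟩) * ψ (z.shift μ) + (1 - conj (u ⟨z.unshift μ, μ⟩)) * ψ (z.unshift μ)) +
          ∑ z, (χc z * K z) * ((a' : ℂ) * ((Qu *ᵥ ψ) z - (Q1 *ᵥ ψ) z)))‖ +
        ‖(P.eps⁻¹ : ℂ) ^ 2 * ∑ z, (∑ μ : Fin P.d,
            ((χc (z.shift μ) - χc z) * K (z.shift μ) + (χc (z.unshift μ) - χc z) * K (z.unshift μ))) * ψ z +
          ∑ z, ((a' : ℂ) * (χc z * (Q1 *ᵥ K) z - (Q1 *ᵥ fun w => χc w * K w) z)) * ψ z‖ := norm_add_le _ _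
    _ ≤ (P.eps⁻¹ ^ 2 * ‖∑ z, (χc z * K z) * ∑ μ : Fin P.d,
            ((1 - u ⟨z, μ⟩) * ψ (z.shift μ) + (1 - conj (u ⟨z.unshift μ, μ⟩)) * ψ (z.unshift μ))‖ +
          ‖∑ z, (χc z * K z) * ((a' : ℂ) * ((Qu *ᵥ ψ) z - (Q1 *ᵥ ψ) z))‖) +
        (P.eps⁻¹ ^ 2 * ‖∑ z, (∑ μ : Fin P.d,
            ((χc (z.shift μ) - χc z) * K (z.shift μ) + (χc (z.unshift μ) - χc z) * K (z.unshift μ))) * ψ z‖ +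
          ‖∑ z, ((a' : ℂ) * (χc z * (Q1 *ᵥ K) z - (Q1 *ᵥ fun w => χc w * K w) z)) * ψ z‖) := by
        rw [norm_neg]
        refine add_le_add ((norm_add_le _ _).trans ?_) ((norm_add_le _ _).trans ?_)
        · rw [norm_mul, hε2]
        · rw [norm_mul, hε2]
    _ ≤ _ := by
        have hε0 : 0 ≤ P.eps⁻¹ ^ 2 := sq_nonneg _
        nlinarith [mul_le_mul_of_nonneg_left hPD hε0, mul_le_mul_of_nonneg_left hCD hε0, hPQ, hCQ]

/-- kernel: sup-balls are monotone in the radius. [folklore] -/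
private theorem ball_subset_ball (y₀ : Balaban1983to89.Site P 0) {n n' : ℕ} (h : n ≤ n') : ball y₀ n ⊆ ball y₀ n' :=
  fun _ hz => mem_ball.2 ((mem_ball.1 hz).trans h)

/-- kernel: `√(Σ_{ball n}g²) ≤ √(Σ_{ball n′}g²)` for `n ≤ n′`. [folklore] -/
private theorem sqrt_ball_mono (y₀ : Balaban1983to89.Site P 0) {n n' : ℕ} (h : n ≤ n') (g : Balaban1983to89.Site P 0 → ℝ) :
    Real.sqrt (∑ z ∈ ball y₀ n, g z ^ 2) ≤ Real.sqrt (∑ z ∈ ball y₀ n', g z ^ 2) :=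
  Real.sqrt_le_sqrt (Finset.sum_le_sum_of_subset_of_nonneg (ball_subset_ball y₀ h) fun _ _ _ => sq_nonneg _)

/-- kernel: `α_k·ε²·(L^k)² = a_k` (`α_k = a_k(L^kε)^{−2}`). [cite: Balaban1982Higgs1, (2.20) p.610] -/
private theorem alpha_mul_eps_sq (a : ℝ) (k : ℕ) :
    B1RG242Torus.α P a k * (P.eps ^ 2 * ((P.L : ℝ) ^ k) ^ 2) = B1.aSeq a P.L k := by
  have hε : P.eps ≠ 0 := P.eps_pos.ne'
  have hL : (P.L : ℝ) ^ k ≠ 0 := pow_ne_zero _ P.cast_L_pos.ne'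
  rw [B1RG242Torus.α]
  unfold Params.spacing
  field_simp

/-- kernel: `√((cn+1)^d) ≤ √((c+1)^d)·√(n^d)` for `n ≥ 1`, `c ≥ 0`. [folklore] -/
private theorem sqrt_pow_affine_le {c n : ℝ} (hc : 0 ≤ c) (hn : 1 ≤ n) (d : ℕ) :
    Real.sqrt ((c * n + 1) ^ d) ≤ Real.sqrt ((c + 1) ^ d) * Real.sqrt (n ^ d) := by
  rw [← Real.sqrt_mul (by positivity), ← mul_pow]
  refine Real.sqrt_le_sqrt (pow_le_pow_left₀ (by positivity) ?_ d)
  nlinarith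

/-- kernel: **the flat whole-torus propagator is a symmetric matrix** (the inverse of the real symmetric `N♭`).
[cite: BalabanImbrieJaffe1985, (4.6.2) p.313] -/
private theorem gBox_flat_symm {a : ℝ} (ha : 0 < a) {k : ℕ} (hk1 : 1 ≤ k) (hk : k ≤ P.m + P.K) (x z : Balaban1983to89.Site P 0) :
    gBox (B1RG242Torus.α P a k * (P.L : ℝ) ^ (k * P.d)) P.eps⁻¹ (1 : GaugeField P 0 U1) k univ x z =
      gBox (B1RG242Torus.α P a k * (P.L : ℝ) ^ (k * P.d)) P.eps⁻¹ (1 : GaugeField P 0 U1) k univ z x := by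
  set a' : ℝ := B1RG242Torus.α P a k * (P.L : ℝ) ^ (k * P.d) with ha'def
  set Gf := gBox a' P.eps⁻¹ (1 : GaugeField P 0 U1) k univ with hGf
  set Nf := nOp a' P.eps⁻¹ (1 : GaugeField P 0 U1) k univ with hNf
  have hk0 : 0 + k ≤ P.m + P.K := by omega
  have hα : 0 < B1RG242Torus.α P a k :=
    mul_pos (B1.aSeq_pos ha (B1RG242Torus.one_lt_cast_L P) hk1) (inv_pos.2 (pow_pos (P.spacing_pos k) 2))
  have ha' : 0 < a' := mul_pos hα (pow_pos P.cast_L_pos _)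
  have hc : P.eps⁻¹ ≠ 0 := inv_ne_zero P.eps_pos.ne'
  have hGN : Gf * Nf = 1 := (gBox_univ_mul hk0 hc ha' (1 : GaugeField P 0 U1)).1
  have hNt : Nfᵀ = Nf := nOp_flat_transpose a hk
  have h1 : Nf * Gfᵀ = 1 := by
    have h := congrArg Matrix.transpose hGN
    rw [Matrix.transpose_mul, Matrix.transpose_one, hNt] at h
    exact h
  have hsymm : Gfᵀ = Gf := by
    calc Gfᵀ = (Gf * Nf) * Gfᵀ := by rw [hGN, Matrix.one_mul]
      _ = Gf * (Nf * Gfᵀ) := Matrix.mul_assoc _ _ _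
      _ = Gf := by rw [h1, Matrix.mul_one]
  have h := congr_fun (congr_fun hsymm z) x
  rw [Matrix.transpose_apply] at h
  exact h

open BIJ85ScalarPropagatorTorus BIJ85ScalarPropagatorTorusK in
open BIJ85ScalarForm464 (opT) in
/-- kernel: **Caccioppoli at the block scale** (sibling `BIJ85SmallFieldHarmonicAgmon.caccioppoli` through the bridge
`BIJ88NeumannPropagatorWholeTorus.opT_eq_nLin`): if `(N(u)ψ)(z) = 0` on `|y₀ − z|_∞ ≤ 4L^k + 2` then
`√(Σ_{T≤2L^k}Σ_μ‖u_{z,μ}ψ(z+e_μ) − ψ(z)‖²) ≤ √(d + a/2)/L^k · √(Σ_{T≤5L^k+2}‖ψ‖²)` (`ε⁻²‖D_uψ‖²` against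
`(2L^k+1)^{−2}(dε⁻² + a_kε⁻²/2)Σ‖ψ‖²`, `a_k ≤ a`). [cite: BalabanImbrieJaffe1985, (4.6.2) p.313, p.326] -/
private theorem covEnergy_le {a : ℝ} (ha : 0 < a) {k : ℕ} (hk1 : 1 ≤ k) (hk : k ≤ P.m + P.K) (y₀ : Balaban1983to89.Site P 0)
    (U : GaugeField P 0 U1) (ψ : Balaban1983to89.Site P 0 → ℂ)
    (hψ : ∀ z, supDist y₀ z ≤ 4 * P.L ^ k + 2 →
      (nOp (B1RG242Torus.α P a k * (P.L : ℝ) ^ (k * P.d)) P.eps⁻¹ U k univ *ᵥ ψ) z = 0) :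
    Real.sqrt (∑ z ∈ ball y₀ (2 * P.L ^ k), ∑ μ : Fin P.d, ‖cfg U ⟨z, μ⟩ * ψ (z.shift μ) - ψ z‖ ^ 2) ≤
      Real.sqrt (P.d + a / 2) / (P.L : ℝ) ^ k * Real.sqrt (∑ z ∈ ball y₀ (5 * P.L ^ k + 2), ‖ψ z‖ ^ 2) := by
  set a' : ℝ := B1RG242Torus.α P a k * (P.L : ℝ) ^ (k * P.d) with ha'def
  have hk0 : 0 + k ≤ P.m + P.K := by omega
  have hα : 0 < B1RG242Torus.α P a k :=
    mul_pos (B1.aSeq_pos ha (B1RG242Torus.one_lt_cast_L P) hk1) (inv_pos.2 (pow_pos (P.spacing_pos k) 2))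
  have ha' : 0 < a' := mul_pos hα (pow_pos P.cast_L_pos _)
  have haSeq : B1.aSeq a P.L k ≤ a := B1.aSeq_le ha (B1RG242Torus.one_lt_cast_L P) k hk1
  set n : ℝ := (P.L : ℝ) ^ k with hn
  have hn0 : 0 < n := pow_pos P.cast_L_pos k
  have hr1 : 1 ≤ P.L ^ k := Nat.one_le_pow _ _ P.L_pos
  have hncast : ((P.L ^ k : ℕ) : ℝ) = n := by rw [hn]; push_cast; rfl
  set W := Real.sqrt (∑ z ∈ ball y₀ (2 * P.L ^ k), ∑ μ : Fin P.d, ‖cfg U ⟨z, μ⟩ * ψ (z.shift μ) - ψ z‖ ^ 2) with hW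
  set E₃ := Real.sqrt (∑ z ∈ ball y₀ (5 * P.L ^ k + 2), ‖ψ z‖ ^ 2) with hE₃
  set q : ℝ := Real.sqrt (P.d + a / 2) with hq
  have hW0 : 0 ≤ W := Real.sqrt_nonneg _
  have hE₃0 : 0 ≤ E₃ := Real.sqrt_nonneg _
  have hq0 : 0 ≤ q := Real.sqrt_nonneg _
  set φ : FineSp P 0 := WithLp.toLp 2 ψ with hφ
  have hT : ∀ x, supDist y₀ x ≤ 2 * (2 * P.L ^ k + 1) → opT (Dlin P.eps⁻¹ U) (QlinK U k) a' φ x = 0 := by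
    intro x hx
    rw [BIJ88NeumannPropagatorWholeTorus.opT_eq_nLin]
    show (WithLp.ofLp (BIJ88NeumannPropagatorWholeTorus.nLin a' P.eps⁻¹ U k φ)) x = 0
    rw [BIJ88NeumannPropagatorWholeTorus.ofLp_nLin, hφ, WithLp.ofLp_toLp]
    exact hψ x (by omega)
  have hcacc := BIJ85SmallFieldHarmonicAgmon.caccioppoli hk0 P.eps⁻¹ ha'.le U φ y₀ (ρ := 2 * P.L ^ k + 1) (by omega) hT
  have e1 : 2 * P.L ^ k + 1 - 1 = 2 * P.L ^ k := by omega
  have e2 : 2 * (2 * P.L ^ k + 1) + P.L ^ k = 5 * P.L ^ k + 2 := by ring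
  rw [e1, e2] at hcacc
  have hW2 : W ^ 2 = ∑ z ∈ ball y₀ (2 * P.L ^ k), ∑ μ : Fin P.d, ‖cfg U ⟨z, μ⟩ * ψ (z.shift μ) - ψ z‖ ^ 2 :=
    Real.sq_sqrt (sum_nonneg fun _ _ => sum_nonneg fun _ _ => sq_nonneg _)
  have hE2 : E₃ ^ 2 = ∑ z ∈ ball y₀ (5 * P.L ^ k + 2), ‖ψ z‖ ^ 2 := Real.sq_sqrt (sum_nonneg fun _ _ => sq_nonneg _)
  have hcacc' : P.eps⁻¹ ^ 2 * W ^ 2 ≤ ((2 * P.L ^ k + 1 : ℕ) : ℝ)⁻¹ ^ 2 *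
      (P.d * P.eps⁻¹ ^ 2 + a' / 2 * ((P.L : ℝ) ^ (k * P.d))⁻¹ * ((P.L : ℝ) ^ k) ^ 2) * E₃ ^ 2 := by
    rw [hW2, hE2]; exact hcacc
  have hcoef : (P.d * P.eps⁻¹ ^ 2 + a' / 2 * ((P.L : ℝ) ^ (k * P.d))⁻¹ * ((P.L : ℝ) ^ k) ^ 2) =
      P.eps⁻¹ ^ 2 * (P.d + B1.aSeq a P.L k / 2) := by
    rw [← alpha_mul_eps_sq a k, ha'def]
    have hN0 : (P.L : ℝ) ^ (k * P.d) ≠ 0 := pow_ne_zero _ P.cast_L_pos.ne'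
    have hε : P.eps ≠ 0 := P.eps_pos.ne'
    field_simp
  rw [hcoef] at hcacc'
  have hρ : n ≤ ((2 * P.L ^ k + 1 : ℕ) : ℝ) := by
    rw [← hncast]; exact_mod_cast (by omega : P.L ^ k ≤ 2 * P.L ^ k + 1)
  have hε2 : 0 < P.eps⁻¹ ^ 2 := by have := P.eps_pos; positivity
  have h4 : W ^ 2 ≤ ((2 * P.L ^ k + 1 : ℕ) : ℝ)⁻¹ ^ 2 * (P.d + B1.aSeq a P.L k / 2) * E₃ ^ 2 := by
    refine le_of_mul_le_mul_left ?_ hε2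
    calc P.eps⁻¹ ^ 2 * W ^ 2 ≤ _ := hcacc'
      _ = P.eps⁻¹ ^ 2 * (((2 * P.L ^ k + 1 : ℕ) : ℝ)⁻¹ ^ 2 * (P.d + B1.aSeq a P.L k / 2) * E₃ ^ 2) := by ring
  have h5 : ((2 * P.L ^ k + 1 : ℕ) : ℝ)⁻¹ ^ 2 ≤ n⁻¹ ^ 2 := by
    refine pow_le_pow_left₀ (by positivity) ?_ 2
    exact (inv_le_inv₀ (by positivity) hn0).2 hρ
  have h6 : (P.d : ℝ) + B1.aSeq a P.L k / 2 ≤ q ^ 2 := by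
    rw [hq, Real.sq_sqrt (by positivity)]; linarith
  have hdq : 0 ≤ (P.d : ℝ) + B1.aSeq a P.L k / 2 := by
    have := (B1.aSeq_pos ha (B1RG242Torus.one_lt_cast_L P) hk1).le; positivity
  have h3 : W ^ 2 ≤ (q / n * E₃) ^ 2 := by
    calc W ^ 2 ≤ ((2 * P.L ^ k + 1 : ℕ) : ℝ)⁻¹ ^ 2 * (P.d + B1.aSeq a P.L k / 2) * E₃ ^ 2 := h4
      _ ≤ n⁻¹ ^ 2 * q ^ 2 * E₃ ^ 2 := by gcongr
      _ = (q / n * E₃) ^ 2 := by ring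
  exact (pow_le_pow_iff_left₀ hW0 (by positivity) two_ne_zero).1 h3

/-- kernel: the algebra of the Laplacian-commutator product (pure real arithmetic). [folklore] -/
private theorem alg_C (d : ℕ) (hd : 1 ≤ d) {ε n γ C₀ C₁ q E W E₃ s B : ℝ} (hε : 0 < ε) (hn : 0 < n) (hγ : 0 ≤ γ)
    (hC₀ : 0 ≤ C₀) (hC₁ : 0 ≤ C₁) (hq : 0 ≤ q) (hE : 0 ≤ E) (hW : 0 ≤ W) (hE₃ : 0 ≤ E₃) (hs : 0 < s)
    (hs2 : s ^ 2 = n ^ d) (hE3 : E ≤ E₃) (hWb : W ≤ q / n * E₃) (hBs : B ≤ Real.sqrt (5 ^ d) * s) :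
    ε⁻¹ ^ 2 * (d * ((2 / n) ^ (d - 1) / n * B *
        (C₁ * ε ^ 2 * E + C₀ * ε ^ 2 * n * W + 2 * γ * n * (C₀ * ε ^ 2 * n) * E))) * s ≤
      d * (2 ^ (d - 1) * Real.sqrt (5 ^ d)) * (C₁ + C₀ * q + 2 * C₀) * (1 + γ * n ^ 2) * E₃ := by
  have hW' : C₀ * ε ^ 2 * n * W ≤ C₀ * ε ^ 2 * q * E₃ := by
    calc C₀ * ε ^ 2 * n * W ≤ C₀ * ε ^ 2 * n * (q / n * E₃) := by gcongr
      _ = C₀ * ε ^ 2 * q * E₃ := by field_simp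
  have hE' : C₁ * ε ^ 2 * E ≤ C₁ * ε ^ 2 * E₃ := by gcongr
  have hE'' : 2 * γ * n * (C₀ * ε ^ 2 * n) * E ≤ 2 * γ * n * (C₀ * ε ^ 2 * n) * E₃ := by gcongr
  have h1 : C₁ * ε ^ 2 * E + C₀ * ε ^ 2 * n * W + 2 * γ * n * (C₀ * ε ^ 2 * n) * E ≤
      ε ^ 2 * ((C₁ + C₀ * q + 2 * C₀ * (γ * n ^ 2)) * E₃) := by linarith
  have hX0 : 0 ≤ C₁ * ε ^ 2 * E + C₀ * ε ^ 2 * n * W + 2 * γ * n * (C₀ * ε ^ 2 * n) * E := by positivity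
  have hnd : n ^ d = n ^ (d - 1) * n := by rw [← pow_succ, Nat.sub_add_cancel hd]
  have hkey : (2 / n) ^ (d - 1) / n * (s * s) = 2 ^ (d - 1) := by
    rw [← sq, hs2, hnd, div_pow]; field_simp
  have h2 : (C₁ + C₀ * q + 2 * C₀ * (γ * n ^ 2)) ≤ (C₁ + C₀ * q + 2 * C₀) * (1 + γ * n ^ 2) := by
    have hg : 0 ≤ γ * n ^ 2 := by positivity
    nlinarith [mul_nonneg hC₁ hg, mul_nonneg (mul_nonneg hC₀ hq) hg, hC₀]
  calc ε⁻¹ ^ 2 * (d * ((2 / n) ^ (d - 1) / n * B *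
        (C₁ * ε ^ 2 * E + C₀ * ε ^ 2 * n * W + 2 * γ * n * (C₀ * ε ^ 2 * n) * E))) * s
      ≤ ε⁻¹ ^ 2 * (d * ((2 / n) ^ (d - 1) / n * (Real.sqrt (5 ^ d) * s) *
        (ε ^ 2 * ((C₁ + C₀ * q + 2 * C₀ * (γ * n ^ 2)) * E₃)))) * s := by gcongr
    _ = (ε⁻¹ ^ 2 * ε ^ 2) * ((2 / n) ^ (d - 1) / n * (s * s)) * (d * Real.sqrt (5 ^ d) *
        ((C₁ + C₀ * q + 2 * C₀ * (γ * n ^ 2)) * E₃)) := by ring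
    _ = d * (2 ^ (d - 1) * Real.sqrt (5 ^ d)) * ((C₁ + C₀ * q + 2 * C₀ * (γ * n ^ 2)) * E₃) := by
        rw [hkey, show ε⁻¹ ^ 2 * ε ^ 2 = 1 by field_simp]; ring
    _ ≤ d * (2 ^ (d - 1) * Real.sqrt (5 ^ d)) * (((C₁ + C₀ * q + 2 * C₀) * (1 + γ * n ^ 2)) * E₃) := by gcongr
    _ = _ := by ring

/-- kernel: the algebra of the Laplacian-perturbation product (pure real arithmetic). [folklore] -/
private theorem alg_D (d : ℕ) {ε n γ C₀ C₁ q E W E₃ s S sd : ℝ} (hε : 0 < ε) (hn : 0 < n) (hγ : 0 ≤ γ) (hC₀ : 0 ≤ C₀)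
    (hC₁ : 0 ≤ C₁) (hq : 0 ≤ q) (hE : 0 ≤ E) (hW : 0 ≤ W) (hE₃ : 0 ≤ E₃)
    (hE3 : E ≤ E₃) (hWb : W ≤ q / n * E₃) (hSs : S * s ≤ 4 * Real.sqrt sd * n ^ 2) :
    ε⁻¹ ^ 2 * (d * (γ * S * (C₀ * ε ^ 2 * n * W + (2 ^ (d - 1) * (C₀ * ε ^ 2 * n) / n + C₁ * ε ^ 2) * E))) * s ≤
      d * (4 * Real.sqrt sd) * (C₀ * q + 2 ^ (d - 1) * C₀ + C₁) * (1 + γ * n ^ 2) * E₃ := by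
  have hW' : C₀ * ε ^ 2 * n * W ≤ C₀ * ε ^ 2 * q * E₃ := by
    calc C₀ * ε ^ 2 * n * W ≤ C₀ * ε ^ 2 * n * (q / n * E₃) := by gcongr
      _ = C₀ * ε ^ 2 * q * E₃ := by field_simp
  have hc : 2 ^ (d - 1) * (C₀ * ε ^ 2 * n) / n + C₁ * ε ^ 2 = ε ^ 2 * (2 ^ (d - 1) * C₀ + C₁) := by field_simp
  have hE' : (2 ^ (d - 1) * (C₀ * ε ^ 2 * n) / n + C₁ * ε ^ 2) * E ≤ ε ^ 2 * (2 ^ (d - 1) * C₀ + C₁) * E₃ := by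
    rw [hc]; gcongr
  have h1 : C₀ * ε ^ 2 * n * W + (2 ^ (d - 1) * (C₀ * ε ^ 2 * n) / n + C₁ * ε ^ 2) * E ≤
      ε ^ 2 * ((C₀ * q + 2 ^ (d - 1) * C₀ + C₁) * E₃) := by linarith
  have hX0 : 0 ≤ ε ^ 2 * ((C₀ * q + 2 ^ (d - 1) * C₀ + C₁) * E₃) := by positivity
  calc ε⁻¹ ^ 2 * (d * (γ * S * (C₀ * ε ^ 2 * n * W + (2 ^ (d - 1) * (C₀ * ε ^ 2 * n) / n + C₁ * ε ^ 2) * E))) * s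
      = ε⁻¹ ^ 2 * d * γ * (S * s) * (C₀ * ε ^ 2 * n * W + (2 ^ (d - 1) * (C₀ * ε ^ 2 * n) / n + C₁ * ε ^ 2) * E) := by ring
    _ ≤ ε⁻¹ ^ 2 * d * γ * (4 * Real.sqrt sd * n ^ 2) * (ε ^ 2 * ((C₀ * q + 2 ^ (d - 1) * C₀ + C₁) * E₃)) := by
        have hA : 0 ≤ ε⁻¹ ^ 2 * d * γ := by positivity
        have hX : 0 ≤ C₀ * ε ^ 2 * n * W + (2 ^ (d - 1) * (C₀ * ε ^ 2 * n) / n + C₁ * ε ^ 2) * E := by positivity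
        exact mul_le_mul (mul_le_mul_of_nonneg_left hSs hA) h1 hX (by positivity)
    _ = (ε⁻¹ ^ 2 * ε ^ 2) * (γ * n ^ 2) * (d * (4 * Real.sqrt sd) * (C₀ * q + 2 ^ (d - 1) * C₀ + C₁) * E₃) := by ring
    _ = (γ * n ^ 2) * (d * (4 * Real.sqrt sd) * (C₀ * q + 2 ^ (d - 1) * C₀ + C₁) * E₃) := by
        rw [show ε⁻¹ ^ 2 * ε ^ 2 = 1 by field_simp, one_mul]
    _ ≤ (1 + γ * n ^ 2) * (d * (4 * Real.sqrt sd) * (C₀ * q + 2 ^ (d - 1) * C₀ + C₁) * E₃) := by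
        have h0 : 0 ≤ d * (4 * Real.sqrt sd) * (C₀ * q + 2 ^ (d - 1) * C₀ + C₁) * E₃ := by positivity
        nlinarith
    _ = _ := by ring

/-- kernel: the algebra of the two block products (pure real arithmetic). [folklore] -/
private theorem alg_Q (d : ℕ) {ε n a aS C₀ E₂ E₃ s B₂ X Y γ : ℝ} (hε : 0 < ε) (hn : 1 ≤ n) (hC₀ : 0 ≤ C₀) (haS0 : 0 ≤ aS)
    (haS : aS ≤ a) (hE₂ : 0 ≤ E₂) (hE₃ : 0 ≤ E₃) (hs : 0 < s) (hB₂ : 0 ≤ B₂) (hX : 0 ≤ X) (hY : 0 ≤ Y) (hγ : 0 ≤ γ)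
    (hs2 : s ^ 2 = n ^ d) (hE23 : E₂ ≤ E₃) (hB₂s : B₂ ≤ Real.sqrt (7 ^ d) * s) (hXY : X * Y = aS / (ε ^ 2 * n ^ 2 * n ^ d)) :
    (2 * X * Y * (C₀ * ε ^ 2 * n * (1 + 2 * d * 3 ^ (d - 1) * (2 * n + 2 * n))) * B₂ * E₂ +
        2 * X * Y * (C₀ * ε ^ 2 * n * (1 + 2 * d * 3 ^ (d - 1) * (2 * n))) * B₂ * E₂) * s ≤
      2 * a * C₀ * (2 + 6 * (2 * d * 3 ^ (d - 1))) * Real.sqrt (7 ^ d) * (1 + γ * n ^ 2) * E₃ := by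
  have hn0 : 0 < n := by linarith
  set c : ℝ := 2 * d * 3 ^ (d - 1) with hc
  have hc0 : 0 ≤ c := by positivity
  have hm1 : 1 + c * (2 * n + 2 * n) ≤ (1 + 4 * c) * n := by nlinarith
  have hm2 : 1 + c * (2 * n) ≤ (1 + 2 * c) * n := by nlinarith
  have hBE : B₂ * E₂ * s ≤ Real.sqrt (7 ^ d) * n ^ d * E₃ := by
    calc B₂ * E₂ * s ≤ (Real.sqrt (7 ^ d) * s) * E₃ * s := by gcongr
      _ = Real.sqrt (7 ^ d) * (s * s) * E₃ := by ring
      _ = Real.sqrt (7 ^ d) * n ^ d * E₃ := by rw [← sq, hs2]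
  have hXYa : X * Y * (ε ^ 2 * n ^ 2 * n ^ d) = aS := by
    rw [hXY]; field_simp
  calc (2 * X * Y * (C₀ * ε ^ 2 * n * (1 + c * (2 * n + 2 * n))) * B₂ * E₂ +
        2 * X * Y * (C₀ * ε ^ 2 * n * (1 + c * (2 * n))) * B₂ * E₂) * s
      = 2 * (X * Y) * C₀ * ε ^ 2 * n * ((1 + c * (2 * n + 2 * n)) + (1 + c * (2 * n))) * (B₂ * E₂ * s) := by ring
    _ ≤ 2 * (X * Y) * C₀ * ε ^ 2 * n * ((1 + 4 * c) * n + (1 + 2 * c) * n) * (Real.sqrt (7 ^ d) * n ^ d * E₃) := by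
        have h0 : 0 ≤ 2 * (X * Y) * C₀ * ε ^ 2 * n := by positivity
        exact mul_le_mul (mul_le_mul_of_nonneg_left (add_le_add hm1 hm2) h0) hBE (by positivity) (by positivity)
    _ = 2 * (X * Y * (ε ^ 2 * n ^ 2 * n ^ d)) * C₀ * (2 + 6 * c) * Real.sqrt (7 ^ d) * E₃ := by ring
    _ = 2 * aS * C₀ * (2 + 6 * c) * Real.sqrt (7 ^ d) * E₃ := by rw [hXYa]
    _ ≤ 2 * a * C₀ * (2 + 6 * c) * Real.sqrt (7 ^ d) * E₃ := by gcongr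
    _ ≤ 2 * a * C₀ * (2 + 6 * c) * Real.sqrt (7 ^ d) * (1 + γ * n ^ 2) * E₃ := by
        have ha0 : 0 ≤ a := haS0.trans haS
        have h0 : 0 ≤ 2 * a * C₀ * (2 + 6 * c) * Real.sqrt (7 ^ d) * E₃ := by positivity
        have hγn : 0 ≤ γ * n ^ 2 := by positivity
        nlinarith

/-- kernel: `√((4n+1)^d) ≤ √(5^d)√(n^d)` (`n ≥ 1`). [folklore] -/
private theorem sqrt_ball_two {n : ℝ} (hn : 1 ≤ n) (d : ℕ) :
    Real.sqrt ((2 * (2 * n) + 1) ^ d) ≤ Real.sqrt (5 ^ d) * Real.sqrt (n ^ d) := by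
  have h := sqrt_pow_affine_le (by norm_num : (0 : ℝ) ≤ 4) hn d
  rw [show (4 : ℝ) + 1 = 5 by norm_num] at h
  refine le_trans (le_of_eq ?_) h
  ring_nf

/-- kernel: `√((6n+1)^d) ≤ √(7^d)√(n^d)` (`n ≥ 1`). [folklore] -/
private theorem sqrt_ball_three {n : ℝ} (hn : 1 ≤ n) (d : ℕ) :
    Real.sqrt ((2 * (2 * n + n) + 1) ^ d) ≤ Real.sqrt (7 ^ d) * Real.sqrt (n ^ d) := by
  have h := sqrt_pow_affine_le (by norm_num : (0 : ℝ) ≤ 6) hn d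
  rw [show (6 : ℝ) + 1 = 7 by norm_num] at h
  refine le_trans (le_of_eq ?_) h
  ring_nf

/-- kernel: `√(s_d(2n)^{4−d})·√(n^d) ≤ 4√(s_d)·n²` (`d ≤ 4`, `n > 0`). [folklore] -/
private theorem sqrt_radial_le {d : ℕ} (hd4 : d ≤ 4) {n sd : ℝ} (hn : 0 < n) (hsd : 0 ≤ sd) :
    Real.sqrt (sd * (2 * n) ^ (4 - d)) * Real.sqrt (n ^ d) ≤ 4 * Real.sqrt sd * n ^ 2 := by
  rw [← Real.sqrt_mul (by positivity)]
  have e : sd * (2 * n) ^ (4 - d) * n ^ d = sd * (2 ^ (4 - d) * n ^ 4) := by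
    have h4 : n ^ 4 = n ^ (4 - d) * n ^ d := by rw [← pow_add]; congr 1; omega
    rw [h4, mul_pow]; ring
  rw [e]
  have h16 : (2 : ℝ) ^ (4 - d) ≤ 16 := by
    calc (2 : ℝ) ^ (4 - d) ≤ 2 ^ 4 := pow_le_pow_right₀ (by norm_num) (by omega)
      _ = 16 := by norm_num
  calc Real.sqrt (sd * (2 ^ (4 - d) * n ^ 4)) ≤ Real.sqrt (sd * (16 * n ^ 4)) := Real.sqrt_le_sqrt (by gcongr)
    _ = 4 * Real.sqrt sd * n ^ 2 := by
        rw [Real.sqrt_mul hsd, show (16 : ℝ) * n ^ 4 = (4 * n ^ 2) ^ 2 by ring, Real.sqrt_sq (by positivity)]; ring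

set_option maxHeartbeats 400000 in
/-- **THE LOCAL MEAN-VALUE INEQUALITY AT THE BLOCK SCALE** for functions harmonic for the whole-torus operator
`N(u) = ε^{−2}D_u^*D_u + a_k(L^kε)^{−2}L^{kd}Q_k(u)ᴴQ_k(u)` of [BalabanImbrieJaffe1985] (4.6.2) (p31's `nOp (α_kL^{kd}) ε⁻¹ u k T`) at
non-flat `U(1)` fields in a gauge with linear growth from the centre: for `2 ≤ d ≤ 3`, odd `L > 1`, `a > 0` there is `C > 0` (a function of
`d, L, a`) such that for EVERY volume `P` (`P.d = d`, `P.L = L`), every `1 ≤ k ≤ K` with `4L^k + 6 ≤` sites per direction, every centre `y₀`,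
field `u`, function `ψ` with `(N(u)ψ)(z) = 0` on `|y₀ − z|_∞ ≤ 4L^k + 2`, and `γ ≥ 0` with `|u_{z,μ} − 1| ≤ γ|y₀ − z|_∞` on `|y₀ − z|_∞ ≤ 2L^k`:
`‖ψ(y₀)‖·√((L^k)^d) ≤ C(1 + γL^{2k})·√(Σ_{|y₀−z|_∞ ≤ 5L^k+2}‖ψ(z)‖²)` — the value at the centre is controlled by the `ℓ²`-AVERAGE over the
ball of radius `5L^k + 2`, uniformly in `k` (a gain `L^{−kd/2}` over the trivial bound).  Ingredients: the localized representation through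
the flat propagator (§2) with the product tent cutoff of flat radius `L^k`, the flat kernel envelopes `flat_kernel_value` /
`BIJ85FlatPropagatorKernelDiffs.flat_kernel_diffs`, the four `ℓ²` term bounds (§4), and Caccioppoli's inequality
`BIJ85SmallFieldHarmonicAgmon.caccioppoli` for the covariant energy on the ball of radius `2L^k`.  (The print: *"The propagators arising
from Δ_k(u_k) … also satisfy the regularity and decay estimates of [7]"* — this inequality is the `L² → L^∞` step of our energy-method proof
of [7] (1.11)–(1.12) at small non-flat fields, sibling file `BIJ88NeumannPropagatorSmallFieldClose`; DIVERGENCE OF METHOD disclosed in the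
module docstring.) [cite: BalabanImbrieJaffe1985, (4.6.2) p.313, p.326] [cite: Balaban1983RegularityDecay, Theorem p.573 (1.10)–(1.12)] -/
theorem harmonic_meanValue (d L : ℕ) (hd : 2 ≤ d) (hd3 : d ≤ 3) (hL : Odd L ∧ 1 < L) {a : ℝ} (ha : 0 < a) :
    ∃ C : ℝ, 0 < C ∧ ∀ (P : Params), P.d = d → P.L = L → ∀ k : ℕ, 1 ≤ k → k ≤ P.K → 4 * P.L ^ k + 6 ≤ P.sitesPerDir 0 →
      ∀ (y₀ : Balaban1983to89.Site P 0) (U : GaugeField P 0 U1) (ψ : Balaban1983to89.Site P 0 → ℂ) (γ : ℝ), 0 ≤ γ →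
        (∀ z, supDist y₀ z ≤ 4 * P.L ^ k + 2 →
          (nOp (B1RG242Torus.α P a k * (P.L : ℝ) ^ (k * P.d)) P.eps⁻¹ U k univ *ᵥ ψ) z = 0) →
        (∀ z (μ : Fin P.d), supDist y₀ z ≤ 2 * P.L ^ k → ‖cfg U ⟨z, μ⟩ - 1‖ ≤ γ * supDist y₀ z) →
        ‖ψ y₀‖ * Real.sqrt (((P.L : ℝ) ^ k) ^ P.d) ≤
          C * (1 + γ * ((P.L : ℝ) ^ k) ^ 2) * Real.sqrt (∑ z ∈ ball y₀ (5 * P.L ^ k + 2), ‖ψ z‖ ^ 2) := by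
  obtain ⟨C₀, hC₀, hV⟩ := flat_kernel_value d L hd hL ha (le_refl (0 : ℝ))
  obtain ⟨C₁, hC₁, hDf⟩ := flat_kernel_diffs d L hd hL ha (le_refl (0 : ℝ))
  -- the constant
  set sd : ℝ := 2 * d * 3 ^ (d - 1) with hsd
  have hsd0 : 0 ≤ sd := by positivity
  set q : ℝ := Real.sqrt (d + a / 2) with hq
  have hq0 : 0 ≤ q := Real.sqrt_nonneg _
  set cC : ℝ := d * (2 ^ (d - 1) * Real.sqrt (5 ^ d)) * (C₁ + C₀ * q + 2 * C₀) with hcC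
  set cD : ℝ := d * (4 * Real.sqrt sd) * (C₀ * q + 2 ^ (d - 1) * C₀ + C₁) with hcD
  set cQ : ℝ := 2 * a * C₀ * (2 + 6 * sd) * Real.sqrt (7 ^ d) with hcQ
  have hcC0 : 0 ≤ cC := by positivity
  have hcD0 : 0 ≤ cD := by positivity
  have hcQ0 : 0 ≤ cQ := by positivity
  refine ⟨cC + cD + cQ + 1, by positivity, ?_⟩
  intro P hPd hPL k hk1 hkK hN y₀ U ψ γ hγ hψ hu
  subst hPd; subst hPL
  -- basic quantities
  have hk : k ≤ P.m + P.K := hkK.trans (Nat.le_add_left _ _)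
  have hr2 : 2 ≤ P.L ^ k := Nat.one_lt_pow (by omega) P.hL.2
  have hr1 : 1 ≤ P.L ^ k := by omega
  set n : ℝ := (P.L : ℝ) ^ k with hn
  have hncast : ((P.L ^ k : ℕ) : ℝ) = n := by rw [hn]; push_cast; rfl
  have hn0 : 0 < n := pow_pos P.cast_L_pos k
  have hn1 : 1 ≤ n := by rw [← hncast]; exact_mod_cast hr1
  have hε : 0 < P.eps := P.eps_pos
  have hα : 0 < B1RG242Torus.α P a k :=
    mul_pos (B1.aSeq_pos ha (B1RG242Torus.one_lt_cast_L P) hk1) (inv_pos.2 (pow_pos (P.spacing_pos k) 2))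
  have haSeq : B1.aSeq a P.L k ≤ a := B1.aSeq_le ha (B1RG242Torus.one_lt_cast_L P) k hk1
  have haSeq0 : 0 ≤ B1.aSeq a P.L k := (B1.aSeq_pos ha (B1RG242Torus.one_lt_cast_L P) hk1).le
  have hNn : (P.L : ℝ) ^ (k * P.d) = n ^ P.d := by rw [hn, ← pow_mul]
  have hνn : (((P.L : ℝ) ^ P.d)⁻¹) ^ k = (n ^ P.d)⁻¹ := by
    rw [hn, inv_pow, ← pow_mul, ← pow_mul, Nat.mul_comm P.d k]
  -- the flat kernel envelopes of the row `y₀`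
  have hGf : ∀ x z, gBox (B1RG242Torus.α P a k * (P.L : ℝ) ^ (k * P.d)) P.eps⁻¹ (1 : GaugeField P 0 U1) k univ x z =
      ((B1RG242Torus.tower P a 0).G k x z : ℂ) := fun x z => by
    rw [gBox_flat_eq_tower ha hk1 hk, Matrix.map_apply, Complex.ofRealHom_eq_coe]
  have hK0 : ∀ z, ‖gBox (B1RG242Torus.α P a k * (P.L : ℝ) ^ (k * P.d)) P.eps⁻¹ (1 : GaugeField P 0 U1) k univ y₀ z‖ ≤
      C₀ * P.eps ^ 2 * n / (max (supDist y₀ z : ℝ) 1) ^ (P.d - 1) := fun z => by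
    rw [hGf, Complex.norm_real, Real.norm_eq_abs]; exact hV P rfl rfl k hk1 hkK y₀ z
  have hK1 : ∀ z (ν : Fin P.d),
      ‖gBox (B1RG242Torus.α P a k * (P.L : ℝ) ^ (k * P.d)) P.eps⁻¹ (1 : GaugeField P 0 U1) k univ y₀ (z.shift ν) -
        gBox (B1RG242Torus.α P a k * (P.L : ℝ) ^ (k * P.d)) P.eps⁻¹ (1 : GaugeField P 0 U1) k univ y₀ z‖ ≤
      C₁ * P.eps ^ 2 / (max (supDist y₀ z : ℝ) 1) ^ (P.d - 1) := fun z ν => by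
    rw [gBox_flat_symm ha hk1 hk y₀ (z.shift ν), gBox_flat_symm ha hk1 hk y₀ z, hGf, hGf, ← Complex.ofReal_sub,
      Complex.norm_real, Real.norm_eq_abs, supDist_comm y₀ z]
    exact (hDf P rfl rfl k hk1 hkK).1 ν z y₀
  -- the abstract inequality at `r = L^k`
  have hmain := local_meanValue_abstract hd3 ha hk1 hk hr2 hN y₀ U ψ (fun z hz => hψ z (by omega))
    (by positivity : 0 ≤ C₀ * P.eps ^ 2 * n) (by positivity : 0 ≤ C₁ * P.eps ^ 2) hγ hK0 hK1 hu
  rw [hncast] at hmain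
  -- the `ℓ²` quantities
  set E := Real.sqrt (∑ z ∈ ball y₀ (2 * P.L ^ k), ‖ψ z‖ ^ 2) with hE
  set W := Real.sqrt (∑ z ∈ ball y₀ (2 * P.L ^ k), ∑ μ : Fin P.d, ‖cfg U ⟨z, μ⟩ * ψ (z.shift μ) - ψ z‖ ^ 2) with hW
  set E₂ := Real.sqrt (∑ z ∈ ball y₀ (2 * P.L ^ k + P.L ^ k), ‖ψ z‖ ^ 2) with hE₂
  set E₃ := Real.sqrt (∑ z ∈ ball y₀ (5 * P.L ^ k + 2), ‖ψ z‖ ^ 2) with hE₃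
  have hE3 : E ≤ E₃ := sqrt_ball_mono y₀ (by omega) fun z => ‖ψ z‖
  have hE23 : E₂ ≤ E₃ := sqrt_ball_mono y₀ (by omega) fun z => ‖ψ z‖
  have hE₂0 : 0 ≤ E₂ := Real.sqrt_nonneg _
  have hE₃0 : 0 ≤ E₃ := Real.sqrt_nonneg _
  have hW0 : 0 ≤ W := Real.sqrt_nonneg _
  have hWb : W ≤ q / n * E₃ := covEnergy_le ha hk1 hk y₀ U ψ hψ
  -- ball sizes against `s = √(n^d)`
  set s : ℝ := Real.sqrt (n ^ P.d) with hs
  have hs0 : 0 < s := Real.sqrt_pos.2 (pow_pos hn0 _)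
  have hs2 : s ^ 2 = n ^ P.d := Real.sq_sqrt (pow_nonneg hn0.le _)
  have hB₁ : Real.sqrt ((2 * (2 * n) + 1) ^ P.d) ≤ Real.sqrt (5 ^ P.d) * s := sqrt_ball_two hn1 P.d
  have hB₂ : Real.sqrt ((2 * (2 * n + n) + 1) ^ P.d) ≤ Real.sqrt (7 ^ P.d) * s := sqrt_ball_three hn1 P.d
  have hSD : Real.sqrt (2 * P.d * 3 ^ (P.d - 1) * (2 * n) ^ (4 - P.d)) * s ≤ 4 * Real.sqrt sd * n ^ 2 := by
    rw [hsd]; exact sqrt_radial_le (by omega) hn0 (by positivity)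
  -- `a′·ν_k = a_k/(ε²n²n^d)`
  have hXY : (B1RG242Torus.α P a k * (P.L : ℝ) ^ (k * P.d)) * (((P.L : ℝ) ^ (k * P.d))⁻¹ * (((P.L : ℝ) ^ P.d)⁻¹) ^ k) =
      B1.aSeq a P.L k / (P.eps ^ 2 * n ^ 2 * n ^ P.d) := by
    rw [hνn, hNn, ← alpha_mul_eps_sq a k, ← hn]
    field_simp
  -- the three products against `s`
  have hE0 : 0 ≤ E := Real.sqrt_nonneg _
  have hTC := alg_C P.d P.hd hε hn0 hγ hC₀.le hC₁.le hq0 hE0 hW0 hE₃0 hs0 hs2 hE3 hWb hB₁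
  have hTD := alg_D P.d hε hn0 hγ hC₀.le hC₁.le hq0 hE0 hW0 hE₃0 hE3 hWb hSD
  have hTQ := alg_Q P.d hε hn1 hC₀.le haSeq0 haSeq hE₂0 hE₃0 hs0 (Real.sqrt_nonneg _)
    (by positivity : 0 ≤ B1RG242Torus.α P a k * (P.L : ℝ) ^ (k * P.d)) (by positivity) hγ hs2 hE23 hB₂ hXY
  -- conclusion
  have hmain' := mul_le_mul_of_nonneg_right hmain hs0.le
  have hfin : ‖ψ y₀‖ * s ≤ (cC + cD + cQ) * (1 + γ * n ^ 2) * E₃ := by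
    refine hmain'.trans ?_
    have h := add_le_add (add_le_add hTC hTD) hTQ
    rw [hcC, hcD, hcQ, hsd]
    refine le_trans (le_of_eq ?_) (h.trans (le_of_eq ?_))
    · ring
    · ring
  refine hfin.trans ?_
  have h0 : 0 ≤ (1 + γ * n ^ 2) * E₃ := by positivity
  have h1 : (cC + cD + cQ) * (1 + γ * n ^ 2) * E₃ ≤ (cC + cD + cQ + 1) * ((1 + γ * n ^ 2) * E₃) := by
    rw [mul_assoc]; exact mul_le_mul_of_nonneg_right (by linarith) h0
  linarith [h1]

end MeanValue






end

end Literature.MathematicalPhysics.QuantumFieldTheory.BalabanImbrieJaffe1984to88.BIJ85SmallFieldHarmonicMeanValue
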